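import Literature.NumberTheory.Automorphic.CDTTheorem722
import Literature.NumberTheory.Automorphic.CDTTheorem722Proofs
import Literature.NumberTheory.EllipticCurves.TateModuleTwistNewformEulerFactorsProofs
import Literature.NumberTheory.EllipticCurves.CuspFormLFunctionLevelConductorOfCarayolProofs
import Literature.NumberTheory.EllipticCurves.EisensteinNewformLevelRaising
import Literature.NumberTheory.EllipticCurves.NewformGaloisRepEulerFactors
import Literature.NumberTheory.EllipticCurves.HasseWeilAbelianEulerFactorForallProofs
import Literature.NumberTheory.EllipticCurves.InertiaInvariantsAdditiveProofs
import Literature.NumberTheory.EllipticCurves.ModularityVersionApProofs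
import Literature.NumberTheory.EllipticCurves.RootNumberAtkinLehnerSemistableProofs
import Literature.NumberTheory.GaloisRepresentations.CoinvariantsCharpolyBaseChange
import Literature.NumberTheory.Automorphic.CDTTheorem722ThreeFactsProofs
import Literature.NumberTheory.EllipticCurves.TateModuleIrreducibleFrobenius
import Literature.NumberTheory.EllipticCurves.CuspFormLFunctionLevelConductorProofs
import Literature.NumberTheory.GaloisRepresentations.FramedRepBaseChange
import Literature.NumberTheory.GaloisRepresentations.OddAbsolutelyIrreducibleProofs
import Literature.AlgebraicGeometry.Motives.FaltingsECEndCoreCasesProofs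
import Literature.RepresentationTheory.IrreducibleTwistTransport
import Literature.NumberTheory.EllipticCurves.EichlerShimuraConstructionCongruenceProofs
import Literature.NumberTheory.EllipticCurves.EichlerShimuraConstructionReductionProofs
import Literature.NumberTheory.GaloisRepresentations.FramedRepEquivConj
import Literature.NumberTheory.EllipticCurves.NeronOggShafarevichProofs
import HarnessLib

/-!
# Stub ideas (k = 1, FAMILY 1 recognise & import; generation 3) for `stub_threeImpTwo` of

Generation 3 (2026-08-31) keeps gen 1 + gen 2 below verbatim and APPENDS `§Gen3` at the end: the
CATALOGUED-CHILD road (`eichlerShimuraCongruenceRelation`, the tree's named open content of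
`eichlerShimuraConstruction`) + an Igusa good-reduction leaf in place of `ES_w` / Deligne, and the
`ℓ`-HOLE THEOREM: from the two catalogued facts `eichlerShimuraCongruenceRelation` +
`Carayol1986_eulerFactor` alone, `ρ_{E,ℓ}` modular ∧ `ℓ ∤ N_E` ⇒ `E` modular (and `ℓ ∣ level` needs no
Eichler–Shimura at all); the Igusa-type input is consumed only in the residual case
`ℓ ∤ level ∧ ℓ ∣ N_E`, isolated as the minimal hypothesis `HoleFiller`.

# (gen 2)

Generation 2 (2026-08-31) keeps the gen-1 content below verbatim (re-verified `lean check` rc 0) and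
APPENDS `§Gen2` at the end: the weakest common leaf `RatNewformGaloisRepCofinal` of the k = 1 / 2 / 3
roads, its three proved feeders (Hida 3.26 (1); weak Eichler–Shimura via the tree's `E`-side engines;
strong Eichler–Shimura), the re-glued core and ONE closer for all roads — all PROVED, 0 sorries.

# (gen 1)
`Summits/ABC/ABC/Cruxes/FreyModularity/Lines/Sketch.lean` — helper lemmas H1–H5 and the
conditional closer, ALL PROVED (`lean check` rc 0, 0 sorries; only the three named Literature
facts `Hida2000_thm326_exists_galoisRep`, `Carayol1986_eulerFactor`,
`IsNewformOf.level_eq_conductorNorm` (∀ N) enter, as hypotheses).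

Plan 1 ("Galois road on `V_{p'}(E)` through the tree's twist engine at `ψ = 1`"): BCDT's
(3) ⇒ (2) for the tree's `L`-series notion `BCDT.IsModular` needs neither Eichler–Shimura nor
Faltings: Deligne's construction at ONE auxiliary prime `p'` (`Hida2000_thm326_exists_galoisRep`),
the PROVED recognition theorem (`nonempty_equiv_twist_of_isGaloisRepOfNewform1`), Carayol's
Euler-factor theorem (`Carayol1986_eulerFactor`) and the PROVED `E`-side Euler factors
(`reverse_charpoly_toInertiaCoinvariants_eq_localPolynomialAt'`) give `a_q(f₀) = a_q(E)` and
`q ∣ N ↔ q ∣ N_E` at EVERY prime, whence `IsNewformOf E f₀` at level `N` and `N = N_E` by the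
catalogued Carayol-level fact (per curve: none if `N_E` is squarefree; Carayol's conductor
theorem if `E` is not additive at `2`; plus Saito's `p = 2` leaf of `E` in general).
-/

open scoped NumberField Polynomial MatrixGroups ModularForm
open NumberField IsDedekindDomain IsDedekindDomain.HeightOneSpectrum Field Polynomial
open CongruenceSubgroup Rat.HeightOneSpectrum
open Literature.NumberTheory.EllipticCurves
open Literature.NumberTheory.EllipticCurves.ModularForms
open Literature.NumberTheory.Automorphic
open Literature.NumberTheory.Automorphic.BCDT
open Literature.NumberTheory.GaloisRepresentations
open WeierstrassCurve

namespace Summit.ABC.ABC.Cruxes.FreyModularity.Sketch.StubIdeasThreeImpTwo1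

/-- The stub, verbatim (for the assembly check below). -/
def SigStubThreeImpTwo : Prop :=
  ∀ (W : WeierstrassCurve ℚ) [W.IsElliptic] [NeZero (W.conductorNorm ℤ)] (ℓ : ℕ) [Fact ℓ.Prime],
    W.IsModularGaloisRepTate ℓ → BCDT.IsModular W

/-- The `X`-coefficient of `X² - a X + b` is `-a`. [folklore] -/
theorem coeff_one_X_sq_sub_C_mul_X_add_C' {S : Type*} [CommRing S] (a b : S) :
    (Polynomial.X ^ 2 - Polynomial.C a * Polynomial.X + Polynomial.C b).coeff 1 = -a := by
  simp [Polynomial.coeff_X_pow, Polynomial.coeff_C]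

/-- **H1 (descent with good reduction off `N ℓ`).**  Part 5 of `CDTTheorem722Proofs`
(`exists_isNewform0_cuspCoeff_eq_lFunction_of_isModularGaloisRepTate`) KEEPING the inertia clause:
the trivial-character newform descends to `f₀ ∈ S₂(Γ₀(N))`, Néron–Ogg–Shafarevich
(`neronOggShafarevich_holds`) turns "inertia at `v ∤ N ℓ` acts trivially on `T_ℓ E`" into good
reduction, and the `X`-coefficient of the Frobenius polynomial gives `a_p(f₀) = a_p(E)` for
`p ∤ N ℓ`.  PROVED. -/
theorem H1_exists_isNewform0_hasGoodReductionAt_cuspCoeff_eq (W : WeierstrassCurve ℚ) [W.IsElliptic]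
    (ℓ : ℕ) [Fact ℓ.Prime] (h : W.IsModularGaloisRepTate ℓ) :
    ∃ (N : ℕ) (_ : NeZero N) (f₀ : CuspForm (Gamma0 N) 2), IsNewform0 f₀ ∧
      (∀ v : HeightOneSpectrum (𝓞 ℚ), ¬ ((primesEquiv v : ℕ) ∣ N * ℓ) → W.HasGoodReductionAt v) ∧
      ∀ p : ℕ, p.Prime → ¬ p ∣ N * ℓ → cuspCoeff f₀ p = (W.LFunction p : ℂ) := by
  classical
  have hℓp : ℓ.Prime := Fact.out
  obtain ⟨N, hN, f, K, hK, hA, ι, hnew, hε, hcl⟩ := (isModularGaloisRepTate_iff_weight_two W ℓ).mp h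
  -- descent to `Γ₀(N)`
  have hdia : ∀ d : ZMod N, IsUnit d → diamondOp N 2 d f = f := by
    intro d hd
    obtain ⟨u, rfl⟩ := hd
    rw [hnew.diamondOp_apply_eq_nebentypus_smul u, hε, MulChar.one_apply_coe, one_smul]
  obtain ⟨f₀, hf₀⟩ := exists_liftToGamma1_eq_of_forall_diamondOp_eq 2 f hdia
  have hnew₀ : IsNewform0 f₀ := (isNewform1_liftToGamma1_iff_holds N 2 f₀).mp (hf₀ ▸ hnew)
  have hcoe : (⇑f₀ : UpperHalfPlane → ℂ) = ⇑f := by rw [← hf₀, coe_liftToGamma1_holds]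
  -- good reduction off `N ℓ`: Néron–Ogg–Shafarevich
  have hgood : ∀ v : HeightOneSpectrum (𝓞 ℚ), ¬ ((primesEquiv v : ℕ) ∣ N * ℓ) →
      W.HasGoodReductionAt v := by
    intro v hv
    have hpℓ : (primesEquiv v : ℕ) ≠ ℓ := fun h' ↦ hv (by rw [← h']; exact dvd_mul_left _ _)
    have hℓv : ((ℓ : ℕ) : 𝓞 ℚ) ∉ v.asIdeal := by
      rw [Literature.NumberTheory.GaloisRepresentations.Rat.natCast_mem_asIdeal_iff]
      exact fun h' ↦ hpℓ ((Nat.prime_dvd_prime_iff_eq (primesEquiv v).2 hℓp).mp h')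
    exact W.neronOggShafarevich_holds v ℓ hℓv fun 𝔓 h𝔓 τ hτ ↦ (hcl v hv 𝔓 h𝔓).1 τ hτ
  refine ⟨N, hN, f₀, hnew₀, hgood, fun p hp hpNℓ ↦ ?_⟩
  -- the place `v` of `ℚ` at `p`, a prime of `ℤ̄` above it and an arithmetic Frobenius
  obtain ⟨v, rfl⟩ : ∃ v : HeightOneSpectrum (𝓞 ℚ), (primesEquiv v : ℕ) = p :=
    ⟨primesEquiv.symm ⟨p, hp⟩, by rw [Equiv.apply_symm_apply]⟩
  obtain ⟨𝔓, h𝔓⟩ := primesAbove_nonempty v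
  obtain ⟨σ, hσ⟩ := exists_isArithFrobAt_of_mem_primesAbove_holds (v := v) h𝔓
  have hpℓ : (primesEquiv v : ℕ) ≠ ℓ := fun h' ↦ hpNℓ (by rw [← h']; exact dvd_mul_left _ _)
  have hgoodv : W.HasGoodReductionAt v := hgood v hpNℓ
  have hℓv : ((ℓ : ℕ) : 𝓞 ℚ) ∉ v.asIdeal := by
    rw [Literature.NumberTheory.GaloisRepresentations.Rat.natCast_mem_asIdeal_iff]
    exact fun h' ↦ hpℓ ((Nat.prime_dvd_prime_iff_eq hp hℓp).mp h')
  have htr := W.trace_galoisRepTate_frobenius_of_hasGoodReductionAt_holds ℓ v hℓv hgoodv h𝔓 hσ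
  -- compare the `X`-coefficients of the two characteristic polynomials
  have h1 := congrArg (fun P : Polynomial K ↦ P.coeff 1) ((hcl v hpNℓ 𝔓 h𝔓).2 σ hσ)
  rw [Polynomial.coeff_map, Polynomial.coeff_map, coeff_one_X_sq_sub_C_mul_X_add_C',
    Literature.NumberTheory.EllipticCurves.ModularForms.heckePolynomial,
    coeff_one_X_sq_sub_C_mul_X_add_C', map_neg, map_neg, neg_inj, htr, map_intCast,
    ← map_intCast ι] at h1
  have h2 := congrArg Subtype.val (ι.injective h1)
  change (((W.frobeniusTraceAt v : ℤ) : coeffCharField f) : ℂ) =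
    (UpperHalfPlane.qExpansion 1 ⇑f).coeff (primesEquiv v : ℕ) at h2
  rw [cuspCoeff, hcoe, W.lFunction_primesEquiv_eq_frobeniusTraceAt hgoodv, ← h2]
  norm_cast

/-- **H2 (Deligne at an auxiliary prime + recognition).**  For ANY prime `p'`, Deligne's `ρ_g`
(`g = liftToGamma1 N 2 f₀`, fact `Hida2000_thm326_exists_galoisRep`) is isomorphic to
`V_{p'}(E) ⊗ ℚ̄_{p'}`: the tree's `nonempty_equiv_twist_of_isGaloisRepOfNewform1` at `m = 1`,
`χ₀ = 1`, `ψ = 1` (`FramedRep.twist_one`), `T₀ = N ℓ`, with `hg` from H1 and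
`nebentypus_liftToGamma1_holds`. -/
theorem H2_exists_isGaloisRepOfNewform1_equiv (hD : Hida2000_thm326_exists_galoisRep)
    (W : WeierstrassCurve ℚ) [W.IsElliptic] {N : ℕ} [NeZero N] (f₀ : CuspForm (Gamma0 N) 2)
    (hf₀ : IsNewform0 f₀) {T₀ : ℕ} (hT₀ : T₀ ≠ 0)
    (hfp : ∀ p : ℕ, p.Prime → ¬ p ∣ T₀ → cuspCoeff f₀ p = (W.LFunction p : ℂ))
    (p' : ℕ) [Fact p'.Prime] (ι : PadicAlgCl p' ≃+* ℂ) (VQ : FramedGaloisRep ℚ ℚ_[p'] 2)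
    (hV : ∀ v : HeightOneSpectrum (𝓞 ℚ), (p' : 𝓞 ℚ) ∉ v.asIdeal → W.HasGoodReductionAt v →
      FramedGaloisRep.IsUnramifiedAt v VQ ∧
        FramedGaloisRep.HasFrobCharpolyAt v
          (X ^ 2 - C ((W.LFunction (primesEquiv v : ℕ) : ℤ) : ℚ_[p']) * X +
            C ((primesEquiv v : ℕ) : ℚ_[p'])) VQ) :
    ∃ ρg : FramedGaloisRep ℚ (PadicAlgCl p') 2,
      IsGaloisRepOfNewform1 (liftToGamma1 N 2 f₀)
        ((ι.symm : ℂ →+* PadicAlgCl p').comp (algebraMap (coeffCharField (liftToGamma1 N 2 f₀)) ℂ))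
        {q | q ∣ N * p'} ρg ∧
      ρg.toGaloisRep.IsIrreducible ∧
      Nonempty (ContinuousRep.Equiv ρg.toGaloisRep
        (FramedGaloisRep.toGaloisRep
          (VQ.baseChange (algebraMap ℚ_[p'] (PadicAlgCl p')) (continuous_algebraMap_padicAlgCl p')))) := by
  classical
  have hnew : IsNewform1 (liftToGamma1 N 2 f₀) :=
    (isNewform1_liftToGamma1_iff_holds (N := N) (k := 2) f₀).mpr hf₀
  obtain ⟨ρg, hρg, hirr⟩ := hD (liftToGamma1 N 2 f₀) le_rfl hnew p' ι
  refine ⟨ρg, hρg, hirr, ?_⟩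
  have hf0 : f₀ ≠ 0 := IsNormalized.ne_zero hf₀.2.2
  have hg : ∀ p : ℕ, p.Prime → ¬ p ∣ T₀ * N →
      cuspCoeff (liftToGamma1 N 2 f₀) p = (fun _ : ℕ ↦ (1 : ℂ)) p * (W.LFunction p : ℂ) ∧
        (nebentypus (liftToGamma1 N 2 f₀) (p : ZMod N) : ℂ) = (fun _ : ℕ ↦ (1 : ℂ)) p ^ 2 := by
    intro p hp hpT
    have hpT₀ : ¬ p ∣ T₀ := fun h ↦ hpT (dvd_mul_of_dvd_left h _)
    have hpN : ¬ p ∣ N := fun h ↦ hpT (dvd_mul_of_dvd_right h _)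
    refine ⟨?_, ?_⟩
    · rw [one_mul, ← hfp p hp hpT₀]
      rw [cuspCoeff, cuspCoeff, coe_liftToGamma1_holds N 2 f₀]
    · rw [nebentypus_liftToGamma1_holds (N := N) (k := 2) hf0, one_pow]
      have hu : IsUnit (p : ZMod N) :=
        (ZMod.isUnit_iff_coprime p N).mpr (hp.coprime_iff_not_dvd.mpr hpN)
      rw [MulChar.one_apply hu]
  have hψI : ∀ v : HeightOneSpectrum (𝓞 ℚ), ¬ ((primesEquiv v : Nat.Primes) : ℕ) ∣ 1 →
      ∀ 𝔓 ∈ v.primesAbove, ∀ σ ∈ 𝔓.inertia (absoluteGaloisGroup ℚ),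
        (1 : absoluteGaloisGroup ℚ →ₜ* (PadicAlgCl p')ˣ) σ = 1 := fun _ _ _ _ _ _ ↦ rfl
  have hψF : ∀ v : HeightOneSpectrum (𝓞 ℚ), ¬ ((primesEquiv v : Nat.Primes) : ℕ) ∣ 1 →
      ∀ 𝔓 ∈ v.primesAbove, ∀ σ : absoluteGaloisGroup ℚ, IsArithFrobAt (𝓞 ℚ) σ 𝔓 →
        ((1 : absoluteGaloisGroup ℚ →ₜ* (PadicAlgCl p')ˣ) σ : PadicAlgCl p') =
          ι.symm ((fun _ : ℕ ↦ (1 : ℂ)) (primesEquiv v : ℕ)) := by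
    intros; simp
  obtain ⟨e⟩ := nonempty_equiv_twist_of_isGaloisRepOfNewform1 W p' ι VQ hV 1 (fun _ ↦ (1 : ℂ)) 1
    hψI hψF (liftToGamma1 N 2 f₀) (mul_ne_zero hT₀ (NeZero.ne N)) hg ρg hρg hirr
  rw [FramedRep.twist_one] at e
  exact ⟨e⟩

/-- **H3 (Carayol Euler factors transported to `E`).**  For every place `v ∤ p'`:
`L_v(E, T) = 1 - a_q(f₀) T + ε(q) q T²` in `ℂ[T]` (`q = p_v`, `ε = 𝟙_N` the nebentypus of the
lift).  `f`-side: `Carayol1986_eulerFactor` on `ρ_g`; transport along the equivalence of H2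
(`ContinuousRep.inertiaCoinvariantsCongr_conj_toInertiaCoinvariants`, `LinearEquiv.charpoly_conj`),
along base change (`charpoly_toCoinvariants_map`) and along `eV` to `V_{p'}(E)`; `E`-side: the
PROVED `reverse_charpoly_toInertiaCoinvariants_eq_localPolynomialAt'` (all reduction types). -/
theorem H3_map_localPolynomialAt_eq (hCE : Carayol1986_eulerFactor)
    (W : WeierstrassCurve ℚ) [W.IsElliptic] {N : ℕ} [NeZero N] (f₀ : CuspForm (Gamma0 N) 2)
    (hf₀ : IsNewform0 f₀) (p' : ℕ) [Fact p'.Prime] (ι : PadicAlgCl p' ≃+* ℂ)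
    (ρg : FramedGaloisRep ℚ (PadicAlgCl p') 2)
    (hρg : IsGaloisRepOfNewform1 (liftToGamma1 N 2 f₀)
      ((ι.symm : ℂ →+* PadicAlgCl p').comp (algebraMap (coeffCharField (liftToGamma1 N 2 f₀)) ℂ))
      {q | q ∣ N * p'} ρg)
    (hirr : ρg.toGaloisRep.IsIrreducible)
    (VQ : FramedGaloisRep ℚ ℚ_[p'] 2) (eV : (Fin 2 → ℚ_[p']) ≃ₗ[ℚ_[p']] W.rationalTateModule p')
    (heV : ∀ (σ : absoluteGaloisGroup ℚ) (x : Fin 2 → ℚ_[p']),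
      eV (FramedRep.toRepresentation VQ σ x) = W.rationalGaloisRepTate p' σ (eV x))
    (he : Nonempty (ContinuousRep.Equiv ρg.toGaloisRep
      (FramedGaloisRep.toGaloisRep
        (VQ.baseChange (algebraMap ℚ_[p'] (PadicAlgCl p')) (continuous_algebraMap_padicAlgCl p')))))
    (v : HeightOneSpectrum (𝓞 ℚ)) (hv : (p' : 𝓞 ℚ) ∉ v.asIdeal) :
    (W.localPolynomialAt v).map (Int.castRingHom ℂ) =
      1 - C (cuspCoeff f₀ (primesEquiv v : ℕ)) * X +
        C ((nebentypus (liftToGamma1 N 2 f₀) ((primesEquiv v : ℕ) : ZMod N) : ℂ) *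
          ((primesEquiv v : ℕ) : ℂ)) * X ^ 2 := by
  classical
  haveI := W.module_finite_rationalTateModule_holds p'
  have hq : (primesEquiv v : ℕ).Prime := (primesEquiv v).2
  have hqv : ((primesEquiv v : ℕ) : 𝓞 ℚ) ∈ v.asIdeal := by
    rw [Literature.NumberTheory.GaloisRepresentations.Rat.natCast_mem_asIdeal_iff]
    exact dvd_of_eq (show natGenerator v = (primesEquiv v : ℕ) from rfl)
  have hqp' : (primesEquiv v : ℕ) ≠ p' := fun h ↦ hv (h ▸ hqv)
  -- a prime `𝔔 ∣ v` of `ℤ̄` and an arithmetic Frobenius `σ ∈ D_𝔔`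
  obtain ⟨𝔔, h𝔔⟩ := primesAbove_nonempty v
  haveI : 𝔔.IsPrime := h𝔔.1
  obtain ⟨σ₀, hσ₀⟩ := exists_isArithFrobAt_of_mem_primesAbove_holds (v := v) h𝔔
  set σ : 𝔔.decompositionSubgroup (absoluteGaloisGroup ℚ) := ⟨σ₀, hσ₀.mem_stabilizer⟩ with hσdef
  have hσ : IsArithFrobAt (𝓞 ℚ) (σ : absoluteGaloisGroup ℚ) 𝔔 := hσ₀
  -- (1) Carayol's theorem for `ρ_g`, `g` the lift of `f₀`
  have hnew : IsNewform1 (liftToGamma1 N 2 f₀) :=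
    (isNewform1_liftToGamma1_iff_holds (N := N) (k := 2) f₀).mpr hf₀
  have h1 := hCE (liftToGamma1 N 2 f₀) le_rfl hnew p' ι ρg hρg hirr (primesEquiv v : ℕ) hq hqp' v
    hqv 𝔔 h𝔔 σ hσ
  -- (2) `ρ_g ≅ V ⊗ ℚ̄_{p'}`: isomorphic representations have the same coinvariant charpolys
  obtain ⟨e⟩ := he
  have he' : ∀ (γ : absoluteGaloisGroup ℚ) (x : Fin 2 → PadicAlgCl p'),
      e.toLinearEquiv (ρg.toGaloisRep γ x) = (FramedGaloisRep.toGaloisRep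
        (VQ.baseChange (algebraMap ℚ_[p'] (PadicAlgCl p')) (continuous_algebraMap_padicAlgCl p')))
          γ (e.toLinearEquiv x) :=
    fun γ x ↦ LinearMap.congr_fun (e.isIntertwining' γ) x
  have hconj := ContinuousRep.inertiaCoinvariantsCongr_conj_toInertiaCoinvariants _ _
    e.toLinearEquiv he' 𝔔 σ
  have h2 : ((FramedGaloisRep.toGaloisRep (VQ.baseChange (algebraMap ℚ_[p'] (PadicAlgCl p'))
      (continuous_algebraMap_padicAlgCl p'))).toInertiaCoinvariants 𝔔 σ).charpoly =
      (ρg.toGaloisRep.toInertiaCoinvariants 𝔔 σ).charpoly := by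
    rw [← hconj, LinearEquiv.charpoly_conj]
  rw [← h2] at h1
  -- (3) coinvariants commute with the base change `ℚ_{p'} → ℚ̄_{p'}`
  have hbc : ((FramedGaloisRep.toGaloisRep (VQ.baseChange (algebraMap ℚ_[p'] (PadicAlgCl p'))
      (continuous_algebraMap_padicAlgCl p'))).toInertiaCoinvariants 𝔔 σ).charpoly =
      (((FramedGaloisRep.toGaloisRep VQ).toInertiaCoinvariants 𝔔 σ).charpoly).map
        (algebraMap ℚ_[p'] (PadicAlgCl p')) :=
    charpoly_toCoinvariants_map (algebraMap ℚ_[p'] (PadicAlgCl p'))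
      ((VQ : absoluteGaloisGroup ℚ →* GL (Fin 2) ℚ_[p']).comp
        (𝔔.decompositionSubgroup (absoluteGaloisGroup ℚ)).subtype)
      (𝔔.inertia (𝔔.decompositionSubgroup (absoluteGaloisGroup ℚ))) σ
  have hrev : ∀ {P : ℚ_[p'][X]}, P.Monic →
      (P.map (algebraMap ℚ_[p'] (PadicAlgCl p'))).reverse =
        P.reverse.map (algebraMap ℚ_[p'] (PadicAlgCl p')) := fun hP ↦ by
    rw [Polynomial.reverse, Polynomial.reverse, hP.natDegree_map, Polynomial.reflect_map]
  rw [hbc, hrev (LinearMap.charpoly_monic _)] at h1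
  -- (4) the framing `V ≅ V_{p'}(E)` and the `E`-side Euler factor `L_v(E, T)`
  have hcW := W.continuous_rationalGaloisRepTate_holds p'
  have heV' : ∀ (γ : absoluteGaloisGroup ℚ) (x : Fin 2 → ℚ_[p']),
      eV ((FramedGaloisRep.toGaloisRep VQ) γ x) =
        (rationalTateGaloisRepOf (geomPoints W) p' hcW) γ (eV x) := fun γ x ↦ heV γ x
  have hconj₂ := ContinuousRep.inertiaCoinvariantsCongr_conj_toInertiaCoinvariants _ _ eV heV' 𝔔 σ
  have h3 : ((rationalTateGaloisRepOf (geomPoints W) p' hcW).toInertiaCoinvariants 𝔔 σ).charpoly =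
      ((FramedGaloisRep.toGaloisRep VQ).toInertiaCoinvariants 𝔔 σ).charpoly := by
    rw [← hconj₂, LinearEquiv.charpoly_conj]
  have hE := W.reverse_charpoly_toInertiaCoinvariants_eq_localPolynomialAt' p' hv h𝔔 σ hσ
  rw [h3] at hE
  rw [hE, Polynomial.map_map] at h1
  -- (5) read everything in `ℂ` through `ι`
  have h4 := congrArg (Polynomial.map (ι : PadicAlgCl p' →+* ℂ)) h1
  rw [Polynomial.map_map, RingHom.eq_intCast' (((ι : PadicAlgCl p' →+* ℂ).comp
    ((algebraMap ℚ_[p'] (PadicAlgCl p')).comp (Int.castRingHom ℚ_[p']))))] at h4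
  rw [h4]
  have h21 : ((2 : ℤ) - 1) = 1 := by norm_num
  have hcc : cuspCoeff (liftToGamma1 N 2 f₀) (primesEquiv v : ℕ) = cuspCoeff f₀ (primesEquiv v : ℕ) := by
    rw [cuspCoeff, cuspCoeff, coe_liftToGamma1_holds N 2 f₀]
  simp only [Polynomial.map_add, Polynomial.map_sub, Polynomial.map_mul, Polynomial.map_pow,
    Polynomial.map_one, map_X, map_C, RingEquiv.coe_toRingHom, RingEquiv.apply_symm_apply, h21,
    zpow_one, hcc]

/-- The `X`-coefficient of `1 - a X + b X²` is `-a`. [folklore] -/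
theorem coeff_quad_one {S : Type*} [CommRing S] (a b : S) :
    (1 - C a * X + C b * X ^ 2 : S[X]).coeff 1 = -a := by
  simp [Polynomial.coeff_one, Polynomial.coeff_X_pow, Polynomial.coeff_C, Polynomial.coeff_X]

/-- The `X²`-coefficient of `1 - a X + b X²` is `b`. [folklore] -/
theorem coeff_quad_two {S : Type*} [CommRing S] (a b : S) :
    (1 - C a * X + C b * X ^ 2 : S[X]).coeff 2 = b := by
  simp [Polynomial.coeff_one, Polynomial.coeff_X_pow, Polynomial.coeff_C, Polynomial.coeff_X]

/-- **H4 (read off both coefficients).**  From the local identity of H3 at `v`: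
`a_q(f₀) = a_q(E)` (the `T`-coefficient of `L_v(E,T)` is `-a_q(E)` for every reduction type:
`localPolynomialAt_of_hasGoodReductionAt` / `…SplitMultiplicative…` / `…not_hasSplit…` /
`…Additive…` with `LFunction_apply_primesEquiv_of_has…ReductionAt`) and `q ∣ N ↔ q ∣ N_E` (the
`T²`-coefficient is `q` iff good reduction iff `q ∤ N_E` (`dvd_conductorNorm_iff`), and
`ε(q) q = q` iff `q ∤ N`, else `0`, by `nebentypus_liftToGamma1_holds`). -/
theorem H4_cuspCoeff_eq_and_dvd_iff (W : WeierstrassCurve ℚ) [W.IsElliptic] {N : ℕ} [NeZero N]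
    (f₀ : CuspForm (Gamma0 N) 2) (hf₀ : IsNewform0 f₀) (v : HeightOneSpectrum (𝓞 ℚ))
    (hloc : (W.localPolynomialAt v).map (Int.castRingHom ℂ) =
      1 - C (cuspCoeff f₀ (primesEquiv v : ℕ)) * X +
        C ((nebentypus (liftToGamma1 N 2 f₀) ((primesEquiv v : ℕ) : ZMod N) : ℂ) *
          ((primesEquiv v : ℕ) : ℂ)) * X ^ 2) :
    cuspCoeff f₀ (primesEquiv v : ℕ) = (W.LFunction (primesEquiv v : ℕ) : ℂ) ∧
      ((primesEquiv v : ℕ) ∣ N ↔ (primesEquiv v : ℕ) ∣ W.conductorNorm ℤ) := by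
  classical
  have hqp : (primesEquiv v : ℕ).Prime := (primesEquiv v).2
  have hqC : ((primesEquiv v : ℕ) : ℂ) ≠ 0 := Nat.cast_ne_zero.mpr hqp.ne_zero
  have hf0 : f₀ ≠ 0 := IsNormalized.ne_zero hf₀.2.2
  -- the value `ε(q)` of the (trivial mod `N`) nebentypus of the lift
  have hε0 : (primesEquiv v : ℕ) ∣ N →
      nebentypus (liftToGamma1 N 2 f₀) ((primesEquiv v : ℕ) : ZMod N) = 0 := fun hqN ↦ by
    rw [nebentypus_liftToGamma1_holds (N := N) (k := 2) hf0]
    exact MulChar.map_nonunit _ (by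
      rwa [ZMod.isUnit_iff_coprime, hqp.coprime_iff_not_dvd, not_not])
  have hε1 : ¬ (primesEquiv v : ℕ) ∣ N →
      nebentypus (liftToGamma1 N 2 f₀) ((primesEquiv v : ℕ) : ZMod N) = 1 := fun hqN ↦ by
    rw [nebentypus_liftToGamma1_holds (N := N) (k := 2) hf0]
    exact MulChar.one_apply ((ZMod.isUnit_iff_coprime _ N).mpr (hqp.coprime_iff_not_dvd.mpr hqN))
  -- the two coefficients of the identity `hloc`
  have h1 := congrArg (fun P : ℂ[X] ↦ P.coeff 1) hloc
  have h2 := congrArg (fun P : ℂ[X] ↦ P.coeff 2) hloc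
  simp only [Polynomial.coeff_map, eq_intCast, coeff_quad_one, coeff_quad_two] at h1 h2
  rw [W.dvd_conductorNorm_iff v]
  obtain hG | hM | hA :=
    hasGoodReductionAt_or_hasMultiplicativeReductionAt_or_hasAdditiveReductionAt (W := W) (v := v)
  · -- good reduction: `L_v = 1 - a_v X + q X²`
    rw [localPolynomialAt_of_hasGoodReductionAt hG] at h1 h2
    rw [coeff_quad_one] at h1
    rw [coeff_quad_two, natCard_residueField_eq_residueCard] at h2
    refine ⟨?_, ?_⟩
    · rw [W.lFunction_primesEquiv_eq_frobeniusTraceAt hG]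
      -- h1 : ((-t : ℤ) : ℂ) = - a
      push_cast at h1
      first | linear_combination h1 | linear_combination -h1
    · refine iff_of_false (fun hqN ↦ ?_) (not_not.mpr hG)
      rw [hε0 hqN, zero_mul] at h2
      have h1lt := one_lt_residueCard v
      have : (v.residueCard : ℂ) = 0 := by exact_mod_cast h2
      exact absurd (by exact_mod_cast this : v.residueCard = 0) (by omega)
  · -- multiplicative reduction: `L_v = 1 ∓ X`
    have hbad : ¬ W.HasGoodReductionAt v := hM.not_hasGoodReductionAt
    by_cases hs : W.HasSplitMultiplicativeReductionAt v
    · rw [localPolynomialAt_of_hasSplitMultiplicativeReductionAt hs] at h1 h2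
      simp only [coeff_sub, coeff_one, coeff_X, if_neg (one_ne_zero), if_pos rfl] at h1
      simp only [coeff_sub, coeff_one, coeff_X] at h2
      norm_num at h1 h2
      refine ⟨?_, iff_of_true ?_ hbad⟩
      · rw [W.LFunction_apply_primesEquiv_of_hasSplitMultiplicativeReductionAt hs]
        push_cast
        first | linear_combination h1 | linear_combination -h1
      · by_contra hqN
        exact one_ne_zero ((hε1 hqN).symm.trans (h2.resolve_right (by exact_mod_cast hqp.ne_zero)))
    · rw [localPolynomialAt_of_hasMultiplicativeReductionAt_of_not_hasSplitMultiplicativeReductionAt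
        hM hs] at h1 h2
      simp only [coeff_add, coeff_one, coeff_X] at h1 h2
      norm_num at h1 h2
      refine ⟨?_, iff_of_true ?_ hbad⟩
      · rw [W.LFunction_apply_primesEquiv_of_hasMultiplicativeReductionAt_of_not_split hM hs]
        push_cast
        first | linear_combination h1 | linear_combination -h1
      · by_contra hqN
        exact one_ne_zero ((hε1 hqN).symm.trans (h2.resolve_right (by exact_mod_cast hqp.ne_zero)))
  · -- additive reduction: `L_v = 1`
    have hbad : ¬ W.HasGoodReductionAt v := hA.not_hasGoodReductionAt
    rw [localPolynomialAt_of_hasAdditiveReductionAt hA] at h1 h2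
    simp only [coeff_one] at h1 h2
    norm_num at h1 h2
    refine ⟨?_, iff_of_true ?_ hbad⟩
    · rw [W.LFunction_apply_primesEquiv_of_hasAdditiveReductionAt hA]
      push_cast
      first | linear_combination h1 | linear_combination -h1
    · by_contra hqN
      exact one_ne_zero ((hε1 hqN).symm.trans (h2.resolve_right (by exact_mod_cast hqp.ne_zero)))

/-- H5, prime powers: `a_{p^e}(f₀) = a_{p^e}(E)` from `a_p(f₀) = a_p(E)` and `p ∣ N ↔ p ∣ N_E`
(the two-step recursions `IsNewform0.cuspCoeff_prime_pow_add_two` and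
`LFunction_apply_prime_pow_add_two_of_prime` have the same indicator). -/
theorem H5aux_cuspCoeff_prime_pow_eq_lFunction (W : WeierstrassCurve ℚ) [W.IsElliptic]
    [NeZero (W.conductorNorm ℤ)] {N : ℕ} [NeZero N] {f₀ : CuspForm (Gamma0 N) 2}
    (hf : IsNewform0 f₀) {p : ℕ} (hp : p.Prime) (hpd : p ∣ N ↔ p ∣ W.conductorNorm ℤ)
    (hfp : cuspCoeff f₀ p = (W.LFunction p : ℂ)) :
    ∀ e : ℕ, cuspCoeff f₀ (p ^ e) = (W.LFunction (p ^ e) : ℂ)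
  | 0 => by
    rw [pow_zero, W.isMultiplicative_LFunction.map_one, Int.cast_one]
    exact hf.2.2
  | 1 => by rwa [pow_one]
  | e + 2 => by
    rw [hf.cuspCoeff_prime_pow_add_two hp e, W.LFunction_apply_prime_pow_add_two_of_prime hp e,
      H5aux_cuspCoeff_prime_pow_eq_lFunction W hf hp hpd hfp e,
      H5aux_cuspCoeff_prime_pow_eq_lFunction W hf hp hpd hfp (e + 1), hfp]
    by_cases h : p ∣ N
    · rw [if_pos h, if_pos (hpd.mp h)]; push_cast; ring
    · rw [if_neg h, if_neg fun h' ↦ h (hpd.mpr h')]; push_cast; ring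

/-- **H5 (Hecke assembly at level `N`).**  `isNewformOf_of_forall_prime_cuspCoeff_eq`
(`ModularityVersionAp`, typed at level `N_E`) generalised to level `N` under
`∀ p, p ∣ N ↔ p ∣ N_E`: prime powers by `H5aux_cuspCoeff_prime_pow_eq_lFunction`, then
multiplicativity (`IsNewform0.coeff_mul_of_coprime_holds`, `isMultiplicative_LFunction`,
`Nat.recOnPosPrimePosCoprime`).  PROVED. -/
theorem H5_isNewformOf_of_forall_prime_cuspCoeff_eq_of_dvd_iff (W : WeierstrassCurve ℚ) [W.IsElliptic]
    [NeZero (W.conductorNorm ℤ)] {N : ℕ} [NeZero N] {f₀ : CuspForm (Gamma0 N) 2} (hf₀ : IsNewform0 f₀)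
    (hdvd : ∀ p : ℕ, p.Prime → (p ∣ N ↔ p ∣ W.conductorNorm ℤ))
    (hfp : ∀ p : ℕ, p.Prime → cuspCoeff f₀ p = (W.LFunction p : ℂ)) : IsNewformOf W f₀ := by
  refine ⟨hf₀, fun n ↦ ?_⟩
  induction n using Nat.recOnPosPrimePosCoprime with
  | prime_pow p e hp _ =>
    exact H5aux_cuspCoeff_prime_pow_eq_lFunction W hf₀ hp (hdvd p hp) (hfp p hp) e
  | zero =>
    rw [ArithmeticFunction.map_zero, Int.cast_zero]
    exact CuspFormClass.qExpansion_coeff_zero f₀ one_pos (one_mem_strictPeriods_gamma0 _)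
  | one =>
    rw [W.isMultiplicative_LFunction.map_one, Int.cast_one]
    exact hf₀.2.2
  | coprime a b _ _ hab iha ihb =>
    have h := IsNewform0.coeff_mul_of_coprime_holds hf₀ hab
    simp only [cuspCoeff] at iha ihb ⊢
    rw [h, W.isMultiplicative_LFunction.map_mul_of_coprime hab, Int.cast_mul, iha, ihb]

/-- **CORE (per curve, modulo Deligne + Carayol-Euler only): `ρ_{E,ℓ}` modular ⇒ `E` has a newform
at SOME level `N`** — `∃ N, ∃ f₀ ∈ S₂(Γ₀(N))` newform with `aₙ(f₀) = aₙ(E)` for all `n`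
(`IsNewformOf W f₀`).  No Eichler–Shimura curve, no Faltings, no Carayol-level/Saito. PROVED. -/
theorem exists_isNewformOf_of_isModularGaloisRepTate_of_deligne_of_carayolEuler
    (hD : Hida2000_thm326_exists_galoisRep) (hCE : Carayol1986_eulerFactor)
    (W : WeierstrassCurve ℚ) [W.IsElliptic] [NeZero (W.conductorNorm ℤ)] (ℓ : ℕ) [Fact ℓ.Prime]
    (h : W.IsModularGaloisRepTate ℓ) :
    ∃ (N : ℕ) (_ : NeZero N) (f₀ : CuspForm (Gamma0 N) 2), IsNewformOf W f₀ := by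
  classical
  have hℓ : ℓ.Prime := Fact.out
  -- H1: descent, good reduction off `N ℓ`, `a_p(f₀) = a_p(E)` for `p ∤ N ℓ`
  obtain ⟨N, hN, f₀, hf₀, -, hfp⟩ := H1_exists_isNewform0_hasGoodReductionAt_cuspCoeff_eq W ℓ h
  have hNℓ0 : N * ℓ ≠ 0 := mul_ne_zero (NeZero.ne N) hℓ.ne_zero
  -- an auxiliary prime `p' > N ℓ N_E`
  obtain ⟨p', hp'ge, hp'⟩ := Nat.exists_infinite_primes (N * ℓ * W.conductorNorm ℤ + 1)
  haveI : Fact p'.Prime := ⟨hp'⟩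
  have hWpos : 0 < W.conductorNorm ℤ := Nat.pos_of_ne_zero (NeZero.ne _)
  have hle1 : N * ℓ ≤ N * ℓ * W.conductorNorm ℤ := Nat.le_mul_of_pos_right _ hWpos
  have hle2 : W.conductorNorm ℤ ≤ N * ℓ * W.conductorNorm ℤ :=
    Nat.le_mul_of_pos_left _ (Nat.pos_of_ne_zero hNℓ0)
  have hp'Nℓ : ¬ p' ∣ N * ℓ := fun hd ↦ by
    have := Nat.le_of_dvd (Nat.pos_of_ne_zero hNℓ0) hd; omega
  have hp'N : ¬ p' ∣ N := fun hd ↦ hp'Nℓ (dvd_mul_of_dvd_left hd _)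
  have hp'W : ¬ p' ∣ W.conductorNorm ℤ := fun hd ↦ by
    have := Nat.le_of_dvd hWpos hd; omega
  -- H2: Deligne's `ρ_g` at `p'` is `V_{p'}(E) ⊗ ℚ̄_{p'}`
  obtain ⟨ι⟩ := PadicAlgCl.nonempty_ringEquiv_complex p'
  obtain ⟨VQ, eV, heV, hV⟩ := exists_framedGaloisRep_rationalTate W p'
  obtain ⟨ρg, hρg, hirr, he⟩ :=
    H2_exists_isGaloisRepOfNewform1_equiv hD W f₀ hf₀ hNℓ0 hfp p' ι VQ hV
  -- H3 + H4 at every prime `q ≠ p'`; `q = p'` is a prime of good reduction outside `N ℓ`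
  have key : ∀ q : ℕ, q.Prime →
      cuspCoeff f₀ q = (W.LFunction q : ℂ) ∧ (q ∣ N ↔ q ∣ W.conductorNorm ℤ) := by
    intro q hq
    by_cases hqp : q = p'
    · subst hqp
      exact ⟨hfp q hq hp'Nℓ, iff_of_false hp'N hp'W⟩
    · set v : HeightOneSpectrum (𝓞 ℚ) := primesEquiv.symm ⟨q, hq⟩ with hvdef
      have hvq : (primesEquiv v : ℕ) = q := by rw [hvdef, Equiv.apply_symm_apply]
      have hv : (p' : 𝓞 ℚ) ∉ v.asIdeal := by
        intro hmem
        have hdvd : (primesEquiv v : ℕ) ∣ p' := by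
          have h1 : Rat.HeightOneSpectrum.natGenerator v ∣ p' := by
            rw [Rat.HeightOneSpectrum.natGenerator_dvd_iff, Ideal.mem_map_of_equiv]
            exact ⟨p', hmem, map_natCast _ p'⟩
          exact h1
        rw [hvq, Nat.dvd_prime hp'] at hdvd
        rcases hdvd with h1 | h1
        · exact hq.one_lt.ne' h1
        · exact hqp h1
      have H := H4_cuspCoeff_eq_and_dvd_iff W f₀ hf₀ v
        (H3_map_localPolynomialAt_eq hCE W f₀ hf₀ p' ι ρg hρg hirr VQ eV heV he v hv)
      rwa [hvq] at H
  -- H5: `IsNewformOf E f₀` at level `N`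
  exact ⟨N, hN, f₀, H5_isNewformOf_of_forall_prime_cuspCoeff_eq_of_dvd_iff W hf₀
    (fun q hq ↦ (key q hq).2) fun q hq ↦ (key q hq).1⟩

/-- **H6 (conditional closer of Plan 1).**  Eichler–Shimura (`eichlerShimuraConstruction`) of the
registered closer `stub_threeImpTwo_of_two_facts` is REPLACED by Deligne's construction and
Carayol's Euler-factor theorem; the Carayol-level fact stays (it is itself
`Carayol1986_artinConductorExponent` + Saito at `2`, `IsNewformOf.level_eq_conductorNorm_of_carayol1986_of_saito`).
PROVED (0 sorries). -/
theorem threeImpTwo_of_deligne_of_carayolEuler (hD : Hida2000_thm326_exists_galoisRep)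
    (hCE : Carayol1986_eulerFactor)
    (hC : ∀ (N : ℕ) [NeZero N], IsNewformOf.level_eq_conductorNorm (N := N)) :
    SigStubThreeImpTwo := by
  intro W _ _ ℓ _ h
  obtain ⟨N, hN, f₀, hWf⟩ :=
    exists_isNewformOf_of_isModularGaloisRepTate_of_deligne_of_carayolEuler hD hCE W ℓ h
  have hNW : N = W.conductorNorm ℤ := hC N hWf
  subst hNW
  exact ⟨f₀, hWf⟩

/-- **Per-curve closer, semistable case: NO Carayol-level / Saito leaf at all** (the proved
`IsNewformOf.level_eq_conductorNorm_of_squarefree`).  PROVED. -/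
theorem isModular_of_isModularGaloisRepTate_of_deligne_of_carayolEuler_of_squarefree
    (hD : Hida2000_thm326_exists_galoisRep) (hCE : Carayol1986_eulerFactor)
    (W : WeierstrassCurve ℚ) [W.IsElliptic] [NeZero (W.conductorNorm ℤ)]
    (hsq : Squarefree (W.conductorNorm ℤ)) (ℓ : ℕ) [Fact ℓ.Prime]
    (h : W.IsModularGaloisRepTate ℓ) : BCDT.IsModular W := by
  obtain ⟨N, hN, f₀, hWf⟩ :=
    exists_isNewformOf_of_isModularGaloisRepTate_of_deligne_of_carayolEuler hD hCE W ℓ h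
  have hNW : N = W.conductorNorm ℤ := hWf.level_eq_conductorNorm_of_squarefree hsq
  subst hNW
  exact ⟨f₀, hWf⟩

/-- **Per-curve closer, `W` not additive above `2`: Deligne + Carayol (Euler AND conductor form),
no Saito leaf** (`IsNewformOf.level_eq_conductorNorm_of_carayol1986_of_forall_not_hasAdditiveReductionAt_two`).
PROVED. -/
theorem isModular_of_isModularGaloisRepTate_of_deligne_of_carayol_of_not_additive_two
    (hD : Hida2000_thm326_exists_galoisRep) (hCE : Carayol1986_eulerFactor)
    (hCA : Carayol1986_artinConductorExponent)
    (W : WeierstrassCurve ℚ) [W.IsElliptic] [NeZero (W.conductorNorm ℤ)]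
    (h2 : ∀ w : HeightOneSpectrum (𝓞 ℚ), ringChar (𝓞 ℚ ⧸ w.asIdeal) = 2 →
      ¬ W.HasAdditiveReductionAt w)
    (ℓ : ℕ) [Fact ℓ.Prime] (h : W.IsModularGaloisRepTate ℓ) : BCDT.IsModular W := by
  obtain ⟨N, hN, f₀, hWf⟩ :=
    exists_isNewformOf_of_isModularGaloisRepTate_of_deligne_of_carayolEuler hD hCE W ℓ h
  have hNW : N = W.conductorNorm ℤ :=
    hWf.level_eq_conductorNorm_of_carayol1986_of_forall_not_hasAdditiveReductionAt_two hCA h2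
  subst hNW
  exact ⟨f₀, hWf⟩

/-- **Per-curve closer, general `W`: Deligne + Carayol (both forms) + Saito's `p = 2` leaf OF THIS
CURVE only** (`IsNewformOf.level_eq_conductorNorm_of_carayol1986_of_saito`).  PROVED. -/
theorem isModular_of_isModularGaloisRepTate_of_deligne_of_carayol_of_saito
    (hD : Hida2000_thm326_exists_galoisRep) (hCE : Carayol1986_eulerFactor)
    (hCA : Carayol1986_artinConductorExponent)
    (W : WeierstrassCurve ℚ) [W.IsElliptic] [NeZero (W.conductorNorm ℤ)]
    (hS : ∀ (ℓ : ℕ) [Fact ℓ.Prime],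
      W.swanConductorAt_rationalTate_eq_wildConductorExponent_of_ringChar_eq_two ℓ)
    (ℓ : ℕ) [Fact ℓ.Prime] (h : W.IsModularGaloisRepTate ℓ) : BCDT.IsModular W := by
  obtain ⟨N, hN, f₀, hWf⟩ :=
    exists_isNewformOf_of_isModularGaloisRepTate_of_deligne_of_carayolEuler hD hCE W ℓ h
  have hNW : N = W.conductorNorm ℤ := hWf.level_eq_conductorNorm_of_carayol1986_of_saito hCA hS
  subst hNW
  exact ⟨f₀, hWf⟩

/-- The same with the Carayol-level fact unfolded into its two catalogued sources. -/
theorem threeImpTwo_of_deligne_of_carayol_of_saito (hD : Hida2000_thm326_exists_galoisRep)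
    (hCE : Carayol1986_eulerFactor) (hCA : Carayol1986_artinConductorExponent)
    (hS : ∀ (V : WeierstrassCurve ℚ) (ℓ : ℕ) [Fact ℓ.Prime],
      V.swanConductorAt_rationalTate_eq_wildConductorExponent_of_ringChar_eq_two ℓ) :
    SigStubThreeImpTwo :=
  threeImpTwo_of_deligne_of_carayolEuler hD hCE
    fun _ _ ↦ fun {V} _ _ hf ↦ hf.level_eq_conductorNorm_of_carayol1986_of_saito hCA (hS V)

/-- Sanity: the verbatim stub follows from the closer. -/
example (hD : Hida2000_thm326_exists_galoisRep) (hCE : Carayol1986_eulerFactor)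
    (hC : ∀ (N : ℕ) [NeZero N], IsNewformOf.level_eq_conductorNorm (N := N)) :
    ∀ (W : WeierstrassCurve ℚ) [W.IsElliptic] [NeZero (W.conductorNorm ℤ)] (ℓ : ℕ) [Fact ℓ.Prime],
      W.IsModularGaloisRepTate ℓ → BCDT.IsModular W :=
  threeImpTwo_of_deligne_of_carayolEuler hD hCE hC

/-! ## §Gen2 (ideator k = 1, generation 2): the WEAKEST COMMON LEAF of the three roads

`RatNewformGaloisRepCofinal` ("`L_A`"): every RATIONAL weight-two newform on `Γ₀(N)` has, for
cofinally many primes `p` and every `ι : ℚ̄_p ≃ ℂ`, an irreducible `ρ : Γ_ℚ → GL₂(ℚ̄_p)` attached to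
its `Γ₁(N)`-lift off `N p`.  It is a HYPOTHESIS SHAPE (the rational weight-two special case of the
catalogued `Hida2000_thm326_exists_galoisRep`; not a new named fact), and it is implied

* (i)  trivially by `Hida2000_thm326_exists_galoisRep` (the k = 1 leaf; PROVED below);
* (ii) by the WEAK Eichler–Shimura statement `EichlerShimuraWeak` ("a rational newform has an
  elliptic curve with good reduction off `N` and `a_p(f) = a_p(E)` for `p ∤ N`" — no `IsNewformOf`,
  no Manin constant, no Faltings) through the tree's PROVED engines: a frame of `V_p(E)`
  (`exists_framedGaloisRep_rationalTate`), irreducibility of `V_p(E)` for cofinally many `p`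
  (`exists_prime_gt_isIrreducible_rationalGaloisRepTate`), `det ρ_{E,p}(c) = -1` (Weil pairing,
  `det_rationalGaloisRepTate_of_isComplexConjugation`), odd + irreducible ⇒ absolutely irreducible
  (`FramedRep.isAbsolutelyIrreducible_of_isIrreducible_of_det_eq_neg_one`), and transport of
  Frobenius polynomials / unramifiedness under `ℚ_p → ℚ̄_p` (PROVED below);
* (iii) by the catalogued strong `eichlerShimuraConstruction` via (ii) (PROVED below).

The CORE is re-glued to consume `L_A` + `Carayol1986_eulerFactor` only
(`exists_isNewformOf_of_isModularGaloisRepTate_of_ratGaloisRep_of_carayolEuler`), so ONE closer serves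
the k = 1 (Deligne), k = 2 (ES-lite) and k = 3 (ES₀) roads; gen-1's closer is recovered as the
instance `hR := ratNewformGaloisRepCofinal_of_hida hD`. -/

/-- **Leaf `L_A` (hypothesis shape).**  For a rational newform `f₀ ∈ S₂(Γ₀(N))` and every bound `B`
there is a prime `p > B` such that for every `ι : ℚ̄_p ≃+* ℂ` some irreducible
`ρ : Γ_ℚ → GL₂(ℚ̄_p)` is attached to `liftToGamma1 N 2 f₀` off `N p` (`IsGaloisRepOfNewform1`,
coefficient map `ι⁻¹ ∘ (K_g ⊆ ℂ)`). -/
def RatNewformGaloisRepCofinal : Prop :=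
  ∀ {N : ℕ} [NeZero N] (f₀ : CuspForm (Gamma0 N) 2), IsNewform0 f₀ →
    (∀ n : ℕ, ∃ z : ℤ, cuspCoeff f₀ n = z) → ∀ B : ℕ,
    ∃ (p : ℕ) (_ : Fact p.Prime), B < p ∧ ∀ ι : PadicAlgCl p ≃+* ℂ,
      ∃ ρ : FramedGaloisRep ℚ (PadicAlgCl p) 2,
        IsGaloisRepOfNewform1 (liftToGamma1 N 2 f₀)
          ((ι.symm : ℂ →+* PadicAlgCl p).comp (algebraMap (coeffCharField (liftToGamma1 N 2 f₀)) ℂ))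
          {q | q ∣ N * p} ρ ∧
        ρ.toGaloisRep.IsIrreducible

/-- **(i) `Hida 3.26 (1)` ⇒ `L_A`** (specialisation; any prime `p > B` will do). PROVED. -/
theorem ratNewformGaloisRepCofinal_of_hida (hD : Hida2000_thm326_exists_galoisRep) :
    RatNewformGaloisRepCofinal := by
  intro N _ f₀ hf₀ _ B
  obtain ⟨p, hBp, hp⟩ := Nat.exists_infinite_primes (B + 1)
  haveI : Fact p.Prime := ⟨hp⟩
  refine ⟨p, ⟨hp⟩, by omega, fun ι ↦ ?_⟩
  exact hD (liftToGamma1 N 2 f₀) le_rfl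
    ((isNewform1_liftToGamma1_iff_holds (N := N) (k := 2) f₀).mpr hf₀) p ι

/-- **Leaf `ES_w` (weak Eichler–Shimura, hypothesis shape).**  A rational newform
`f₀ ∈ S₂(Γ₀(N))` has an elliptic curve `E / ℚ` with good reduction at every `p ∤ N` and
`a_p(f₀) = a_p(E)` for every prime `p ∤ N` (Shimura 1971, Thm. 7.14–7.15 with Igusa; Knapp Thm. 11.74;
DDT 1995, Thm. 1.27 ff.).  Weaker than the catalogued `eichlerShimuraConstruction` (no `aₙ` for all
`n`, no period statement). -/
def EichlerShimuraWeak : Prop :=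
  ∀ {N : ℕ} [NeZero N] (f₀ : CuspForm (Gamma0 N) 2), IsNewform0 f₀ →
    (∀ n : ℕ, ∃ z : ℤ, cuspCoeff f₀ n = z) →
    ∃ (W : WeierstrassCurve ℚ) (_ : W.IsElliptic),
      (∀ v : HeightOneSpectrum (𝓞 ℚ), ¬ ((primesEquiv v : ℕ) ∣ N) → W.HasGoodReductionAt v) ∧
      ∀ p : ℕ, p.Prime → ¬ p ∣ N → cuspCoeff f₀ p = (W.LFunction p : ℂ)

/-- **(iii) strong Eichler–Shimura ⇒ `ES_w`**: `IsNewformOf E f₀` gives `aₙ` for all `n`, and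
`p ∣ N ↔ p ∣ N_E` (`IsNewformOf.dvd_level_iff_dvd_conductorNorm`) with `p ∣ N_E ↔` bad reduction
(`WeierstrassCurve.dvd_conductorNorm_iff`) gives good reduction off `N`.  PROVED. -/
theorem eichlerShimuraWeak_of_eichlerShimuraConstruction (hES : eichlerShimuraConstruction) :
    EichlerShimuraWeak := by
  intro N _ f₀ hf₀ hrat
  obtain ⟨W, hW, hWf, -⟩ := hES hf₀ hrat
  refine ⟨W, hW, fun v hv ↦ ?_, fun p _ _ ↦ hWf.2 p⟩
  by_contra hbad
  exact hv ((hWf.dvd_level_iff_dvd_conductorNorm (primesEquiv v).2).mpr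
    ((W.dvd_conductorNorm_iff v).mpr hbad))

/-- **(ii) `ES_w` ⇒ `L_A` through the tree's proved `E`-side engines** (see the section docstring):
`ρ := V_p(E) ⊗ ℚ̄_p` for a prime `p > B` at which `V_p(E)` is irreducible.  PROVED. -/
theorem ratNewformGaloisRepCofinal_of_eichlerShimuraWeak (hESw : EichlerShimuraWeak) :
    RatNewformGaloisRepCofinal := by
  classical
  intro N _ f₀ hf₀ hrat B
  obtain ⟨W, hW, hgood, hap⟩ := hESw f₀ hf₀ hrat
  obtain ⟨p, hpF, hBp, hirrW⟩ := W.exists_prime_gt_isIrreducible_rationalGaloisRepTate B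
  have hp : p.Prime := hpF.out
  refine ⟨p, hpF, hBp, fun ι ↦ ?_⟩
  obtain ⟨VQ, eV, heV, hV⟩ := exists_framedGaloisRep_rationalTate W p
  have hf0 : f₀ ≠ 0 := IsNormalized.ne_zero hf₀.2.2
  refine ⟨VQ.baseChange (algebraMap ℚ_[p] (PadicAlgCl p)) (continuous_algebraMap_padicAlgCl p),
    fun v hv ↦ ?_, ?_⟩
  · -- attached to the lift of `f₀` off `N p`
    have hq : (primesEquiv v : ℕ).Prime := (primesEquiv v).2
    have hqNp : ¬ (primesEquiv v : ℕ) ∣ N * p := hv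
    have hqN : ¬ (primesEquiv v : ℕ) ∣ N := fun h ↦ hqNp (dvd_mul_of_dvd_left h _)
    have hqp : (primesEquiv v : ℕ) ≠ p := fun h ↦ hqNp (h ▸ dvd_mul_left p N)
    have hpv : (p : 𝓞 ℚ) ∉ v.asIdeal := natCast_not_mem_asIdeal_of_primesEquiv_ne hp hqp
    obtain ⟨hur, hchar⟩ := hV v hpv (hgood v hqN)
    refine ⟨(FramedGaloisRep.isUnramifiedAt_baseChange_iff _ _
      (algebraMap ℚ_[p] (PadicAlgCl p)).injective v VQ).mpr hur, ?_⟩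
    have H := FramedGaloisRep.hasFrobCharpolyAt_baseChange (algebraMap ℚ_[p] (PadicAlgCl p))
      (continuous_algebraMap_padicAlgCl p) hchar
    have hcoeff : (UpperHalfPlane.qExpansion 1 ⇑(liftToGamma1 N 2 f₀)).coeff (primesEquiv v : ℕ) =
        ((W.LFunction (primesEquiv v : ℕ) : ℤ) : ℂ) := by
      rw [← hap _ hq hqN, cuspCoeff, coe_liftToGamma1_holds N 2 f₀]
    have hε : nebentypus (liftToGamma1 N 2 f₀) ((primesEquiv v : ℕ) : ZMod N) = 1 := by
      rw [nebentypus_liftToGamma1_holds (N := N) (k := 2) hf0]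
      exact MulChar.one_apply
        ((ZMod.isUnit_iff_coprime _ N).mpr (hq.coprime_iff_not_dvd.mpr hqN))
    have h21 : ((2 : ℤ) - 1) = 1 := by norm_num
    have hpoly : (heckePolynomial (liftToGamma1 N 2 f₀) (primesEquiv v : Nat.Primes)).map
        ((ι.symm : ℂ →+* PadicAlgCl p).comp
          (algebraMap (coeffCharField (liftToGamma1 N 2 f₀)) ℂ)) =
        (X ^ 2 - C ((W.LFunction (primesEquiv v : ℕ) : ℤ) : ℚ_[p]) * X +
          C ((primesEquiv v : ℕ) : ℚ_[p])).map (algebraMap ℚ_[p] (PadicAlgCl p)) := by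
      rw [← Polynomial.map_map, map_heckePolynomial, hcoeff, hε, one_mul, h21, zpow_one]
      simp only [Polynomial.map_add, Polynomial.map_sub, Polynomial.map_mul, Polynomial.map_pow,
        Polynomial.map_X, map_intCast, map_natCast, Polynomial.map_intCast, Polynomial.map_natCast]
    rw [hpoly]
    exact H
  · -- irreducible over `ℚ̄_p`: `V_p(E)` is irreducible (choice of `p`) and odd (Weil pairing)
    obtain ⟨c, hc⟩ := exists_isComplexConjugation (Rat.castHom ℝ)
    have hcc : c * c = 1 := by rw [← pow_two]; exact hc.sq_eq_one
    have hirrVQ : FramedRep.IsIrreducible VQ :=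
      (Representation.isIrreducible_iff_of_equivariant (FramedRep.toRepresentation VQ)
        (W.rationalGaloisRepTate p) (MonoidHom.id _) Function.surjective_id eV
        (fun g x ↦ by rw [MonoidHom.id_apply]; exact heV g x)).mpr hirrW
    have hconj : FramedRep.toRepresentation VQ c =
        (eV.symm : W.rationalTateModule p →ₗ[ℚ_[p]] (Fin 2 → ℚ_[p])) ∘ₗ
          (W.rationalGaloisRepTate p c : W.rationalTateModule p →ₗ[ℚ_[p]] W.rationalTateModule p) ∘ₗ
            (eV : (Fin 2 → ℚ_[p]) →ₗ[ℚ_[p]] W.rationalTateModule p) := by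
      refine LinearMap.ext fun x ↦ ?_
      simp only [LinearMap.coe_comp, Function.comp_apply, LinearEquiv.coe_coe]
      rw [LinearEquiv.eq_symm_apply, heV]
    have h1 : LinearMap.det (FramedRep.toRepresentation VQ c) = -1 := by
      rw [hconj]
      have h := LinearMap.det_conj
        (W.rationalGaloisRepTate p c : W.rationalTateModule p →ₗ[ℚ_[p]] W.rationalTateModule p) eV.symm
      rw [LinearEquiv.symm_symm] at h
      rw [h]
      exact Literature.AlgebraicGeometry.Motives.det_rationalGaloisRepTate_of_isComplexConjugation W p hc
    have h2 : FramedRep.toRepresentation VQ c =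
        Matrix.toLin' ((VQ c : GL (Fin 2) ℚ_[p]) : Matrix (Fin 2) (Fin 2) ℚ_[p]) :=
      LinearMap.ext fun x ↦ by rw [FramedRep.toRepresentation_apply_apply, Matrix.toLin'_apply]
    have hdet : Matrix.GeneralLinearGroup.det (VQ c) = -1 := by
      ext
      rw [Matrix.GeneralLinearGroup.val_det_apply, Units.val_neg, Units.val_one,
        ← LinearMap.det_toLin', ← h2, h1]
    have habs := FramedRep.isAbsolutelyIrreducible_of_isIrreducible_of_det_eq_neg_one VQ hirrVQ
      two_ne_zero hcc hdet
    exact habs (PadicAlgCl p) (algebraMap ℚ_[p] (PadicAlgCl p))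

/-- **H2′ (recognition with `ρ_g` as INPUT)** — the body of H2 after its first line: any irreducible
`ρ_g` attached to the lift of `f₀` off `N p'` is isomorphic to `V_{p'}(E) ⊗ ℚ̄_{p'}` as soon as
`a_p(f₀) = a_p(E)` off a finite set (`nonempty_equiv_twist_of_isGaloisRepOfNewform1` at `ψ = 1`).
PROVED. -/
theorem H2'_equiv_of_isGaloisRepOfNewform1
    (W : WeierstrassCurve ℚ) [W.IsElliptic] {N : ℕ} [NeZero N] (f₀ : CuspForm (Gamma0 N) 2)
    (hf₀ : IsNewform0 f₀) {T₀ : ℕ} (hT₀ : T₀ ≠ 0)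
    (hfp : ∀ p : ℕ, p.Prime → ¬ p ∣ T₀ → cuspCoeff f₀ p = (W.LFunction p : ℂ))
    (p' : ℕ) [Fact p'.Prime] (ι : PadicAlgCl p' ≃+* ℂ) (VQ : FramedGaloisRep ℚ ℚ_[p'] 2)
    (hV : ∀ v : HeightOneSpectrum (𝓞 ℚ), (p' : 𝓞 ℚ) ∉ v.asIdeal → W.HasGoodReductionAt v →
      FramedGaloisRep.IsUnramifiedAt v VQ ∧
        FramedGaloisRep.HasFrobCharpolyAt v
          (X ^ 2 - C ((W.LFunction (primesEquiv v : ℕ) : ℤ) : ℚ_[p']) * X +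
            C ((primesEquiv v : ℕ) : ℚ_[p'])) VQ)
    (ρg : FramedGaloisRep ℚ (PadicAlgCl p') 2)
    (hρg : IsGaloisRepOfNewform1 (liftToGamma1 N 2 f₀)
      ((ι.symm : ℂ →+* PadicAlgCl p').comp (algebraMap (coeffCharField (liftToGamma1 N 2 f₀)) ℂ))
      {q | q ∣ N * p'} ρg)
    (hirr : ρg.toGaloisRep.IsIrreducible) :
    Nonempty (ContinuousRep.Equiv ρg.toGaloisRep
      (FramedGaloisRep.toGaloisRep
        (VQ.baseChange (algebraMap ℚ_[p'] (PadicAlgCl p')) (continuous_algebraMap_padicAlgCl p')))) := by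
  classical
  have hf0 : f₀ ≠ 0 := IsNormalized.ne_zero hf₀.2.2
  have hg : ∀ p : ℕ, p.Prime → ¬ p ∣ T₀ * N →
      cuspCoeff (liftToGamma1 N 2 f₀) p = (fun _ : ℕ ↦ (1 : ℂ)) p * (W.LFunction p : ℂ) ∧
        (nebentypus (liftToGamma1 N 2 f₀) (p : ZMod N) : ℂ) = (fun _ : ℕ ↦ (1 : ℂ)) p ^ 2 := by
    intro p hp hpT
    have hpT₀ : ¬ p ∣ T₀ := fun h ↦ hpT (dvd_mul_of_dvd_left h _)
    have hpN : ¬ p ∣ N := fun h ↦ hpT (dvd_mul_of_dvd_right h _)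
    refine ⟨?_, ?_⟩
    · rw [one_mul, ← hfp p hp hpT₀]
      rw [cuspCoeff, cuspCoeff, coe_liftToGamma1_holds N 2 f₀]
    · rw [nebentypus_liftToGamma1_holds (N := N) (k := 2) hf0, one_pow]
      have hu : IsUnit (p : ZMod N) :=
        (ZMod.isUnit_iff_coprime p N).mpr (hp.coprime_iff_not_dvd.mpr hpN)
      rw [MulChar.one_apply hu]
  have hψI : ∀ v : HeightOneSpectrum (𝓞 ℚ), ¬ ((primesEquiv v : Nat.Primes) : ℕ) ∣ 1 →
      ∀ 𝔓 ∈ v.primesAbove, ∀ σ ∈ 𝔓.inertia (absoluteGaloisGroup ℚ),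
        (1 : absoluteGaloisGroup ℚ →ₜ* (PadicAlgCl p')ˣ) σ = 1 := fun _ _ _ _ _ _ ↦ rfl
  have hψF : ∀ v : HeightOneSpectrum (𝓞 ℚ), ¬ ((primesEquiv v : Nat.Primes) : ℕ) ∣ 1 →
      ∀ 𝔓 ∈ v.primesAbove, ∀ σ : absoluteGaloisGroup ℚ, IsArithFrobAt (𝓞 ℚ) σ 𝔓 →
        ((1 : absoluteGaloisGroup ℚ →ₜ* (PadicAlgCl p')ˣ) σ : PadicAlgCl p') =
          ι.symm ((fun _ : ℕ ↦ (1 : ℂ)) (primesEquiv v : ℕ)) := by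
    intros; simp
  obtain ⟨e⟩ := nonempty_equiv_twist_of_isGaloisRepOfNewform1 W p' ι VQ hV 1 (fun _ ↦ (1 : ℂ)) 1
    hψI hψF (liftToGamma1 N 2 f₀) (mul_ne_zero hT₀ (NeZero.ne N)) hg ρg hρg hirr
  rw [FramedRep.twist_one] at e
  exact ⟨e⟩

/-- **CORE′ (per curve, modulo `L_A` + Carayol-Euler only): `ρ_{E,ℓ}` modular ⇒ `E` has a newform at
SOME level.**  As gen-1's core, with the rational newform of
`exists_rational_isNewform0_of_isModularGaloisRepTate'` (so that `L_A` applies), the auxiliary prime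
`p' > N ℓ N_E` now supplied by `L_A`, and H2′ in place of H2.  PROVED. -/
theorem exists_isNewformOf_of_isModularGaloisRepTate_of_ratGaloisRep_of_carayolEuler
    (hR : RatNewformGaloisRepCofinal) (hCE : Carayol1986_eulerFactor)
    (W : WeierstrassCurve ℚ) [W.IsElliptic] [NeZero (W.conductorNorm ℤ)] (ℓ : ℕ) [Fact ℓ.Prime]
    (h : W.IsModularGaloisRepTate ℓ) :
    ∃ (N : ℕ) (_ : NeZero N) (f₀ : CuspForm (Gamma0 N) 2), IsNewformOf W f₀ := by
  classical
  have hℓ : ℓ.Prime := Fact.out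
  -- a RATIONAL newform with `a_p(f₀) = a_p(E)` off `T₀ = N ℓ N_E`
  obtain ⟨N, hN, f₀, hf₀, hrat, hfp⟩ := exists_rational_isNewform0_of_isModularGaloisRepTate' W ℓ h
  have hWpos : 0 < W.conductorNorm ℤ := Nat.pos_of_ne_zero (NeZero.ne _)
  have hT₀ : N * (ℓ * W.conductorNorm ℤ) ≠ 0 :=
    mul_ne_zero (NeZero.ne N) (mul_ne_zero hℓ.ne_zero hWpos.ne')
  -- `L_A`: an auxiliary prime `p' > T₀` with an irreducible `ρ_g` for every `ι`
  obtain ⟨p', hp'F, hp'gt, hρ⟩ := hR f₀ hf₀ hrat (N * (ℓ * W.conductorNorm ℤ))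
  have hp' : p'.Prime := hp'F.out
  have hp'T : ¬ p' ∣ N * (ℓ * W.conductorNorm ℤ) := fun hd ↦ by
    have := Nat.le_of_dvd (Nat.pos_of_ne_zero hT₀) hd; omega
  have hp'N : ¬ p' ∣ N := fun hd ↦ hp'T (dvd_mul_of_dvd_left hd _)
  have hp'W : ¬ p' ∣ W.conductorNorm ℤ := fun hd ↦
    hp'T (dvd_mul_of_dvd_right (dvd_mul_of_dvd_right hd _) _)
  obtain ⟨ι⟩ := PadicAlgCl.nonempty_ringEquiv_complex p'
  obtain ⟨VQ, eV, heV, hV⟩ := exists_framedGaloisRep_rationalTate W p'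
  obtain ⟨ρg, hρg, hirr⟩ := hρ ι
  have he := H2'_equiv_of_isGaloisRepOfNewform1 W f₀ hf₀ hT₀ hfp p' ι VQ hV ρg hρg hirr
  -- H3 + H4 at every prime `q ≠ p'`; `q = p'` lies outside `T₀`
  have key : ∀ q : ℕ, q.Prime →
      cuspCoeff f₀ q = (W.LFunction q : ℂ) ∧ (q ∣ N ↔ q ∣ W.conductorNorm ℤ) := by
    intro q hq
    by_cases hqp : q = p'
    · subst hqp
      exact ⟨hfp q hq hp'T, iff_of_false hp'N hp'W⟩
    · set v : HeightOneSpectrum (𝓞 ℚ) := primesEquiv.symm ⟨q, hq⟩ with hvdef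
      have hvq : (primesEquiv v : ℕ) = q := by rw [hvdef, Equiv.apply_symm_apply]
      have hv : (p' : 𝓞 ℚ) ∉ v.asIdeal :=
        natCast_not_mem_asIdeal_of_primesEquiv_ne hp' (hvq ▸ hqp)
      have H := H4_cuspCoeff_eq_and_dvd_iff W f₀ hf₀ v
        (H3_map_localPolynomialAt_eq hCE W f₀ hf₀ p' ι ρg hρg hirr VQ eV heV he v hv)
      rwa [hvq] at H
  exact ⟨N, hN, f₀, H5_isNewformOf_of_forall_prime_cuspCoeff_eq_of_dvd_iff W hf₀
    (fun q hq ↦ (key q hq).2) fun q hq ↦ (key q hq).1⟩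

/-- **Closer′ (the ONE closer for all three roads): `L_A` + Carayol-Euler + Carayol-level ⇒ S9.**
PROVED (0 sorries). -/
theorem threeImpTwo_of_ratGaloisRep_of_carayolEuler (hR : RatNewformGaloisRepCofinal)
    (hCE : Carayol1986_eulerFactor)
    (hC : ∀ (N : ℕ) [NeZero N], IsNewformOf.level_eq_conductorNorm (N := N)) :
    SigStubThreeImpTwo := by
  intro W _ _ ℓ _ h
  obtain ⟨N, hN, f₀, hWf⟩ :=
    exists_isNewformOf_of_isModularGaloisRepTate_of_ratGaloisRep_of_carayolEuler hR hCE W ℓ h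
  have hNW : N = W.conductorNorm ℤ := hC N hWf
  subst hNW
  exact ⟨f₀, hWf⟩

/-- Gen-1's closer is the instance `hR := L_A-from-Hida`. PROVED. -/
theorem threeImpTwo_of_deligne_of_carayolEuler' (hD : Hida2000_thm326_exists_galoisRep)
    (hCE : Carayol1986_eulerFactor)
    (hC : ∀ (N : ℕ) [NeZero N], IsNewformOf.level_eq_conductorNorm (N := N)) :
    SigStubThreeImpTwo :=
  threeImpTwo_of_ratGaloisRep_of_carayolEuler (ratNewformGaloisRepCofinal_of_hida hD) hCE hC

/-- **The Eichler–Shimura-weak road (k = 2 / k = 3 territory) through the SAME closer: no Faltings,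
no Manin constant, no `IsNewformOf` from the construction.** PROVED. -/
theorem threeImpTwo_of_eichlerShimuraWeak_of_carayolEuler (hESw : EichlerShimuraWeak)
    (hCE : Carayol1986_eulerFactor)
    (hC : ∀ (N : ℕ) [NeZero N], IsNewformOf.level_eq_conductorNorm (N := N)) :
    SigStubThreeImpTwo :=
  threeImpTwo_of_ratGaloisRep_of_carayolEuler (ratNewformGaloisRepCofinal_of_eichlerShimuraWeak hESw)
    hCE hC

/-- **Per-curve, semistable: `L_A` + Carayol-Euler, nothing else.** PROVED. -/
theorem isModular_of_isModularGaloisRepTate_of_ratGaloisRep_of_carayolEuler_of_squarefree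
    (hR : RatNewformGaloisRepCofinal) (hCE : Carayol1986_eulerFactor)
    (W : WeierstrassCurve ℚ) [W.IsElliptic] [NeZero (W.conductorNorm ℤ)]
    (hsq : Squarefree (W.conductorNorm ℤ)) (ℓ : ℕ) [Fact ℓ.Prime]
    (h : W.IsModularGaloisRepTate ℓ) : BCDT.IsModular W := by
  obtain ⟨N, hN, f₀, hWf⟩ :=
    exists_isNewformOf_of_isModularGaloisRepTate_of_ratGaloisRep_of_carayolEuler hR hCE W ℓ h
  have hNW : N = W.conductorNorm ℤ := hWf.level_eq_conductorNorm_of_squarefree hsq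
  subst hNW
  exact ⟨f₀, hWf⟩

/-- Sanity (gen 2): the verbatim stub from the weakest leaves `ES_w` + Carayol-Euler + Carayol-level. -/
example (hESw : EichlerShimuraWeak) (hCE : Carayol1986_eulerFactor)
    (hC : ∀ (N : ℕ) [NeZero N], IsNewformOf.level_eq_conductorNorm (N := N)) :
    ∀ (W : WeierstrassCurve ℚ) [W.IsElliptic] [NeZero (W.conductorNorm ℤ)] (ℓ : ℕ) [Fact ℓ.Prime],
      W.IsModularGaloisRepTate ℓ → BCDT.IsModular W :=
  threeImpTwo_of_eichlerShimuraWeak_of_carayolEuler hESw hCE hC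


/-! ## §Gen3 (2026-08-31, generation 3; FAMILY 1 recognise & import — tree match)

### A. The catalogued-child road
The tree already NAMES the open content of `eichlerShimuraConstruction`: the child fact
`eichlerShimuraCongruenceRelation` (`EichlerShimuraCongruenceRelation.lean`, fact-decompose
2026-08-16: `a_p(f) = a_p(E_f)` for `p ∤ N`, `E_f : y² = x³ + a₄x + a₆` the `ℚ`-model of `ℂ/Λ_f`), and
PROVES from it the weak Eichler–Shimura fact `exists_weierstrassCurve_of_rational_isNewform0`
(`exists_weierstrassCurve_of_rational_isNewform0_of_congruenceRelation`).  Gen-2's leaf `ES_w` is that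
child plus ONE uncatalogued input, good reduction of `E_f` off `N` (Igusa 1959 / Shimura 1971 §7 /
Katz–Mazur): `IgusaGoodReduction` below, whence the closer
`threeImpTwo_of_congruenceRelation_of_igusa_of_carayolEuler` (PROVED).

### B. The `ℓ`-hole theorem (the gen-3 increment)
Where exactly is an existence theorem for the compatible system of `f₀` consumed?  Only at the prime
`ℓ`: (i) if `ℓ ∣ N` (the level of the descended newform) then `V_{p'}(E) ⊗ ℚ̄_{p'}` itself is
attached to `f₀` off `N p'` and NO Eichler–Shimura / Deligne input is needed
(`isNewformOf_of_carayolEuler_of_dvd_level`, PROVED); (ii) if `ℓ ∤ N` and `E` is good at `ℓ`, the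
child `eichlerShimuraCongruenceRelation` is consumed at ONE Fourier coefficient, `a_ℓ`, through a
Brauer–Nesbitt transfer between `E_f` and `E` (`hasGoodReductionAt_and_lFunction_eq_of_ae_lFunction_eq`,
PROVED from the tree's `nonempty_equiv_of_hasFrobCharpolyAt_of_finite_of_isIrreducible`,
`isUnramifiedAt_of_equiv`, `hasFrobCharpolyAt_of_equiv`, Néron–Ogg–Shafarevich); (iii) the residual
case `ℓ ∤ N ∧ ℓ ∣ N_E` is the ONLY place where an Igusa-type statement is needed — isolated as
`HoleFiller` (PROVED from `IgusaGoodReduction` + the child by the same transfer).  Net: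
`isModular_of_isModularGaloisRepTate_of_congruenceRelation_of_carayolEuler_of_not_dvd` — from the two
CATALOGUED facts `eichlerShimuraCongruenceRelation`, `Carayol1986_eulerFactor` (+ Carayol-level `hC`,
or nothing for semistable `E`): `ρ_{E,ℓ}` modular ∧ `ℓ ∤ N_E` ⇒ `E` modular.  PROVED, 0 sorries. -/

/-- **The catalogued child fact, verbatim** (`Literature.NumberTheory.EllipticCurves.ModularForms.
eichlerShimuraCongruenceRelation`, `EichlerShimuraCongruenceRelation.lean:105`, fact-decompose 2026-08-16;
restated here only because that statement module has no olean on the farm today (2026-08-31: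
`remote:stale:…:unbuilt`), so it cannot be imported — the two `Prop`s are syntactically identical and
`rfl`-equal once it builds).  For every rational newform `f ∈ S₂(Γ₀(N))` and the `ℚ`-model
`E_f : y² = x³ + a₄x + a₆` of `ℂ/Λ_f`: `a_p(f) = a_p(E_f)` for every prime `p ∤ N`.
[cite: Knapp1993, Thm. 11.74 (d), (e) with Remarks (PDF p. 287)] [cite: Shimura1971, Thm. 7.14/7.15]
[cite: DiamondShurman2005, Thm. 8.7.2 with §8.8] -/
def EichlerShimuraCongruenceRelation : Prop :=
  ∀ (N : ℕ) [NeZero N] (f : CuspForm (Gamma0 N) 2), IsNewform0 f → coeffField f = ⊥ →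
    ∀ (L : PeriodPair), L.lattice.toAddSubgroup = periodLattice f →
      ∀ a₄ a₆ : ℚ, L.g₂ = -4 * (a₄ : ℂ) → L.g₃ = -4 * (a₆ : ℂ) →
        ∀ p : ℕ, p.Prime → ¬ p ∣ N →
          (UpperHalfPlane.qExpansion 1 ⇑f).coeff p =
            (({ a₁ := 0, a₂ := 0, a₃ := 0, a₄ := a₄, a₆ := a₆ } : WeierstrassCurve ℚ).LFunction
              p : ℂ)

/-- **G3.A1** `ES` a.e. at every level from the catalogued child (one line over the tree's
`exists_weierstrassCurve_of_rational_isNewform0_of_congruenceRelation`). PROVED. -/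
theorem eichlerShimuraAE_of_congruenceRelation (hCR : EichlerShimuraCongruenceRelation) :
    ∀ (N : ℕ) [NeZero N], exists_weierstrassCurve_of_rational_isNewform0 (N := N) :=
  fun N _ ↦ exists_weierstrassCurve_of_rational_isNewform0_of_congruenceRelation (hCR N)

/-- **Leaf `Ig` (Igusa 1959; hypothesis shape, same binders as the child fact).**  The `ℚ`-model
`E_f : y² = x³ + a₄x + a₆` of `ℂ/Λ_f` of a rational newform `f ∈ S₂(Γ₀(N))` has good reduction at
every finite place `v` of `ℚ` with `p_v ∤ N` (Igusa 1959: `X₀(N)`, hence `J₀(N)` and its quotient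
`E_f`, has good reduction at `p ∤ N`; Shimura 1971, §7.9 (proof of Thm. 7.14–7.15); Diamond–Shurman,
Thm. 8.8.? is NOT a source — see the card; Katz–Mazur 1985 for `X₀(N)/ℤ[1/N]`; Serre–Tate 1968,
Cor. 2 of Thm. 1 for quotients).  Not in the tree (2026-08-31 `lean search`). -/
def IgusaGoodReduction : Prop :=
  ∀ (N : ℕ) [NeZero N] (f : CuspForm (Gamma0 N) 2), IsNewform0 f → coeffField f = ⊥ →
    ∀ (L : PeriodPair), L.lattice.toAddSubgroup = periodLattice f →
      ∀ a₄ a₆ : ℚ, L.g₂ = -4 * (a₄ : ℂ) → L.g₃ = -4 * (a₆ : ℂ) →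
        ∀ v : HeightOneSpectrum (𝓞 ℚ), ¬ ((primesEquiv v : ℕ) ∣ N) →
          ({ a₁ := 0, a₂ := 0, a₃ := 0, a₄ := a₄, a₆ := a₆ } : WeierstrassCurve ℚ).HasGoodReductionAt v

/-- **G3.A2** child + Igusa ⇒ gen-2's `ES_w` (rationality `K_f = ℚ` from integer coefficients by
`coeffField_eq_bot_of_forall_exists_intCast`; the period pair and `a₄, a₆` exist unconditionally:
`IsNewform0.exists_periodPair_of_coeffField_eq_bot`, `IsNewform0.exists_rat_g₂_g₃_of_lattice_eq_periodLattice`,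
`isElliptic_shortModel`). PROVED. -/
theorem eichlerShimuraWeak_of_congruenceRelation_of_igusa (hCR : EichlerShimuraCongruenceRelation)
    (hIg : IgusaGoodReduction) : EichlerShimuraWeak := by
  intro N _ f₀ hf₀ hrat
  have hQ : coeffField f₀ = ⊥ := coeffField_eq_bot_of_forall_exists_intCast hrat
  obtain ⟨Lf, hLf⟩ := hf₀.exists_periodPair_of_coeffField_eq_bot hQ
  obtain ⟨a₄, a₆, h₂, h₃⟩ := hf₀.exists_rat_g₂_g₃_of_lattice_eq_periodLattice hQ Lf hLf
  exact ⟨_, isElliptic_shortModel h₂ h₃, fun v hv ↦ hIg N f₀ hf₀ hQ Lf hLf a₄ a₆ h₂ h₃ v hv,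
    fun p hp hpN ↦ by rw [cuspCoeff]; exact hCR N f₀ hf₀ hQ Lf hLf a₄ a₆ h₂ h₃ p hp hpN⟩

/-- **G3.A3 (closer, catalogued-child road).**  child + Igusa + Carayol-Euler + Carayol-level ⇒ S9,
through gen-2's one closer. PROVED. -/
theorem threeImpTwo_of_congruenceRelation_of_igusa_of_carayolEuler
    (hCR : EichlerShimuraCongruenceRelation) (hIg : IgusaGoodReduction)
    (hCE : Carayol1986_eulerFactor)
    (hC : ∀ (N : ℕ) [NeZero N], IsNewformOf.level_eq_conductorNorm (N := N)) :
    SigStubThreeImpTwo :=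
  threeImpTwo_of_eichlerShimuraWeak_of_carayolEuler
    (eichlerShimuraWeak_of_congruenceRelation_of_igusa hCR hIg) hCE hC

/-! ### B. The `ℓ`-hole -/

/-- **G3.B0 (descent, same `f₀`, with rationality).**  Gen-1's H1 (good reduction and `a_p` off
`N ℓ`) for ONE newform `f₀` together with `aₙ(f₀) ∈ ℤ` for all `n` (Deligne–Serre (2.7.4) off `N ℓ`,
`IsNewform0.exists_int_eq_coeff_prime_of_off` with `span_integralLattice1_two`, and the Hecke
recursions `IsNewform0.exists_int_eq_cuspCoeff`). PROVED. -/
theorem H1r_exists_rational_isNewform0_hasGoodReductionAt_cuspCoeff_eq (W : WeierstrassCurve ℚ)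
    [W.IsElliptic] (ℓ : ℕ) [Fact ℓ.Prime] (h : W.IsModularGaloisRepTate ℓ) :
    ∃ (N : ℕ) (_ : NeZero N) (f₀ : CuspForm (Gamma0 N) 2), IsNewform0 f₀ ∧
      (∀ n : ℕ, ∃ z : ℤ, cuspCoeff f₀ n = z) ∧
      (∀ v : HeightOneSpectrum (𝓞 ℚ), ¬ ((primesEquiv v : ℕ) ∣ N * ℓ) → W.HasGoodReductionAt v) ∧
      ∀ p : ℕ, p.Prime → ¬ p ∣ N * ℓ → cuspCoeff f₀ p = (W.LFunction p : ℂ) := by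
  have hℓp : ℓ.Prime := Fact.out
  obtain ⟨N, hN, f₀, hf₀, hgood, hap⟩ := H1_exists_isNewform0_hasGoodReductionAt_cuspCoeff_eq W ℓ h
  haveI : NeZero ℓ := ⟨hℓp.ne_zero⟩
  have hprime : ∀ p : ℕ, p.Prime → ∃ z : ℤ, (z : ℂ) = (UpperHalfPlane.qExpansion 1 ⇑f₀).coeff p :=
    hf₀.exists_int_eq_coeff_prime_of_off (by norm_num) (span_integralLattice1_two N) (R := ℓ)
      fun p hp hpM ↦ ⟨W.LFunction p, by rw [Rat.cast_intCast]; exact (hap p hp hpM).symm⟩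
  exact ⟨N, hN, f₀, hf₀, hf₀.exists_int_eq_cuspCoeff (by norm_num) hprime, hgood, hap⟩

/-- **Leaf `L_A` AT ONE NEWFORM** (gen-2's `RatNewformGaloisRepCofinal`, per `f₀`). -/
def RatGaloisRepCofinalAt {N : ℕ} [NeZero N] (f₀ : CuspForm (Gamma0 N) 2) : Prop :=
  ∀ B : ℕ, ∃ (p : ℕ) (_ : Fact p.Prime), B < p ∧ ∀ ι : PadicAlgCl p ≃+* ℂ,
    ∃ ρ : FramedGaloisRep ℚ (PadicAlgCl p) 2,
      IsGaloisRepOfNewform1 (liftToGamma1 N 2 f₀)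
        ((ι.symm : ℂ →+* PadicAlgCl p).comp (algebraMap (coeffCharField (liftToGamma1 N 2 f₀)) ℂ))
        {q | q ∣ N * p} ρ ∧
      ρ.toGaloisRep.IsIrreducible

/-- **G3.B1 (`L_A` at `f₀` from ANY elliptic curve good off `N` carrying `a_p(f₀)` for `p ∤ N`)** —
gen-2's (ii) made per-newform: `ρ := V_p(E) ⊗ ℚ̄_p` for a prime `p > B` with `V_p(E)` irreducible
(`exists_prime_gt_isIrreducible_rationalGaloisRepTate`), absolutely irreducible by oddness. PROVED. -/
theorem ratGaloisRepCofinalAt_of_curve (W : WeierstrassCurve ℚ) [W.IsElliptic] {N : ℕ} [NeZero N]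
    (f₀ : CuspForm (Gamma0 N) 2) (hf₀ : IsNewform0 f₀)
    (hgood : ∀ v : HeightOneSpectrum (𝓞 ℚ), ¬ ((primesEquiv v : ℕ) ∣ N) → W.HasGoodReductionAt v)
    (hap : ∀ p : ℕ, p.Prime → ¬ p ∣ N → cuspCoeff f₀ p = (W.LFunction p : ℂ)) :
    RatGaloisRepCofinalAt f₀ := by
  classical
  intro B
  obtain ⟨p, hpF, hBp, hirrW⟩ := W.exists_prime_gt_isIrreducible_rationalGaloisRepTate B
  have hp : p.Prime := hpF.out
  refine ⟨p, hpF, hBp, fun ι ↦ ?_⟩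
  obtain ⟨VQ, eV, heV, hV⟩ := exists_framedGaloisRep_rationalTate W p
  have hf0 : f₀ ≠ 0 := IsNormalized.ne_zero hf₀.2.2
  refine ⟨VQ.baseChange (algebraMap ℚ_[p] (PadicAlgCl p)) (continuous_algebraMap_padicAlgCl p),
    fun v hv ↦ ?_, ?_⟩
  · -- attached to the lift of `f₀` off `N p`
    have hq : (primesEquiv v : ℕ).Prime := (primesEquiv v).2
    have hqNp : ¬ (primesEquiv v : ℕ) ∣ N * p := hv
    have hqN : ¬ (primesEquiv v : ℕ) ∣ N := fun h ↦ hqNp (dvd_mul_of_dvd_left h _)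
    have hqp : (primesEquiv v : ℕ) ≠ p := fun h ↦ hqNp (h ▸ dvd_mul_left p N)
    have hpv : (p : 𝓞 ℚ) ∉ v.asIdeal := natCast_not_mem_asIdeal_of_primesEquiv_ne hp hqp
    obtain ⟨hur, hchar⟩ := hV v hpv (hgood v hqN)
    refine ⟨(FramedGaloisRep.isUnramifiedAt_baseChange_iff _ _
      (algebraMap ℚ_[p] (PadicAlgCl p)).injective v VQ).mpr hur, ?_⟩
    have H := FramedGaloisRep.hasFrobCharpolyAt_baseChange (algebraMap ℚ_[p] (PadicAlgCl p))
      (continuous_algebraMap_padicAlgCl p) hchar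
    have hcoeff : (UpperHalfPlane.qExpansion 1 ⇑(liftToGamma1 N 2 f₀)).coeff (primesEquiv v : ℕ) =
        ((W.LFunction (primesEquiv v : ℕ) : ℤ) : ℂ) := by
      rw [← hap _ hq hqN, cuspCoeff, coe_liftToGamma1_holds N 2 f₀]
    have hε : nebentypus (liftToGamma1 N 2 f₀) ((primesEquiv v : ℕ) : ZMod N) = 1 := by
      rw [nebentypus_liftToGamma1_holds (N := N) (k := 2) hf0]
      exact MulChar.one_apply
        ((ZMod.isUnit_iff_coprime _ N).mpr (hq.coprime_iff_not_dvd.mpr hqN))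
    have h21 : ((2 : ℤ) - 1) = 1 := by norm_num
    have hpoly : (heckePolynomial (liftToGamma1 N 2 f₀) (primesEquiv v : Nat.Primes)).map
        ((ι.symm : ℂ →+* PadicAlgCl p).comp
          (algebraMap (coeffCharField (liftToGamma1 N 2 f₀)) ℂ)) =
        (X ^ 2 - C ((W.LFunction (primesEquiv v : ℕ) : ℤ) : ℚ_[p]) * X +
          C ((primesEquiv v : ℕ) : ℚ_[p])).map (algebraMap ℚ_[p] (PadicAlgCl p)) := by
      rw [← Polynomial.map_map, map_heckePolynomial, hcoeff, hε, one_mul, h21, zpow_one]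
      simp only [Polynomial.map_add, Polynomial.map_sub, Polynomial.map_mul, Polynomial.map_pow,
        Polynomial.map_X, map_intCast, map_natCast, Polynomial.map_intCast, Polynomial.map_natCast]
    rw [hpoly]
    exact H
  · -- irreducible over `ℚ̄_p`: `V_p(E)` is irreducible (choice of `p`) and odd (Weil pairing)
    obtain ⟨c, hc⟩ := exists_isComplexConjugation (Rat.castHom ℝ)
    have hcc : c * c = 1 := by rw [← pow_two]; exact hc.sq_eq_one
    have hirrVQ : FramedRep.IsIrreducible VQ :=
      (Representation.isIrreducible_iff_of_equivariant (FramedRep.toRepresentation VQ)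
        (W.rationalGaloisRepTate p) (MonoidHom.id _) Function.surjective_id eV
        (fun g x ↦ by rw [MonoidHom.id_apply]; exact heV g x)).mpr hirrW
    have hconj : FramedRep.toRepresentation VQ c =
        (eV.symm : W.rationalTateModule p →ₗ[ℚ_[p]] (Fin 2 → ℚ_[p])) ∘ₗ
          (W.rationalGaloisRepTate p c : W.rationalTateModule p →ₗ[ℚ_[p]] W.rationalTateModule p) ∘ₗ
            (eV : (Fin 2 → ℚ_[p]) →ₗ[ℚ_[p]] W.rationalTateModule p) := by
      refine LinearMap.ext fun x ↦ ?_
      simp only [LinearMap.coe_comp, Function.comp_apply, LinearEquiv.coe_coe]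
      rw [LinearEquiv.eq_symm_apply, heV]
    have h1 : LinearMap.det (FramedRep.toRepresentation VQ c) = -1 := by
      rw [hconj]
      have h := LinearMap.det_conj
        (W.rationalGaloisRepTate p c : W.rationalTateModule p →ₗ[ℚ_[p]] W.rationalTateModule p) eV.symm
      rw [LinearEquiv.symm_symm] at h
      rw [h]
      exact Literature.AlgebraicGeometry.Motives.det_rationalGaloisRepTate_of_isComplexConjugation W p hc
    have h2 : FramedRep.toRepresentation VQ c =
        Matrix.toLin' ((VQ c : GL (Fin 2) ℚ_[p]) : Matrix (Fin 2) (Fin 2) ℚ_[p]) :=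
      LinearMap.ext fun x ↦ by rw [FramedRep.toRepresentation_apply_apply, Matrix.toLin'_apply]
    have hdet : Matrix.GeneralLinearGroup.det (VQ c) = -1 := by
      ext
      rw [Matrix.GeneralLinearGroup.val_det_apply, Units.val_neg, Units.val_one,
        ← LinearMap.det_toLin', ← h2, h1]
    have habs := FramedRep.isAbsolutelyIrreducible_of_isIrreducible_of_det_eq_neg_one VQ hirrVQ
      two_ne_zero hcc hdet
    exact habs (PadicAlgCl p) (algebraMap ℚ_[p] (PadicAlgCl p))

/-- **G3.B2 (per-newform core)** — gen-2's CORE′ with `L_A` at the given `f₀` and an arbitrary finite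
exceptional modulus `T₀`: Carayol-Euler at every prime `q ≠ p'` (gen-1 H3/H4), Hecke assembly (H5).
PROVED. -/
theorem isNewformOf_of_cofinalAt_of_carayolEuler (hCE : Carayol1986_eulerFactor)
    (W : WeierstrassCurve ℚ) [W.IsElliptic] [NeZero (W.conductorNorm ℤ)]
    {N : ℕ} [NeZero N] (f₀ : CuspForm (Gamma0 N) 2) (hf₀ : IsNewform0 f₀) {T₀ : ℕ} (hT₀ : T₀ ≠ 0)
    (hfp : ∀ p : ℕ, p.Prime → ¬ p ∣ T₀ → cuspCoeff f₀ p = (W.LFunction p : ℂ))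
    (hRf : RatGaloisRepCofinalAt f₀) : IsNewformOf W f₀ := by
  classical
  have hWpos : 0 < W.conductorNorm ℤ := Nat.pos_of_ne_zero (NeZero.ne _)
  have hB : T₀ * (N * W.conductorNorm ℤ) ≠ 0 :=
    mul_ne_zero hT₀ (mul_ne_zero (NeZero.ne N) hWpos.ne')
  obtain ⟨p', hp'F, hp'gt, hρ⟩ := hRf (T₀ * (N * W.conductorNorm ℤ))
  have hp' : p'.Prime := hp'F.out
  have hp'B : ¬ p' ∣ T₀ * (N * W.conductorNorm ℤ) := fun hd ↦ by
    have := Nat.le_of_dvd (Nat.pos_of_ne_zero hB) hd; omega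
  have hp'T : ¬ p' ∣ T₀ := fun hd ↦ hp'B (dvd_mul_of_dvd_left hd _)
  have hp'N : ¬ p' ∣ N := fun hd ↦ hp'B (dvd_mul_of_dvd_right (dvd_mul_of_dvd_left hd _) _)
  have hp'W : ¬ p' ∣ W.conductorNorm ℤ := fun hd ↦
    hp'B (dvd_mul_of_dvd_right (dvd_mul_of_dvd_right hd _) _)
  obtain ⟨ι⟩ := PadicAlgCl.nonempty_ringEquiv_complex p'
  obtain ⟨VQ, eV, heV, hV⟩ := exists_framedGaloisRep_rationalTate W p'
  obtain ⟨ρg, hρg, hirr⟩ := hρ ι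
  have he := H2'_equiv_of_isGaloisRepOfNewform1 W f₀ hf₀ hT₀ hfp p' ι VQ hV ρg hρg hirr
  have key : ∀ q : ℕ, q.Prime →
      cuspCoeff f₀ q = (W.LFunction q : ℂ) ∧ (q ∣ N ↔ q ∣ W.conductorNorm ℤ) := by
    intro q hq
    by_cases hqp : q = p'
    · subst hqp
      exact ⟨hfp q hq hp'T, iff_of_false hp'N hp'W⟩
    · set v : HeightOneSpectrum (𝓞 ℚ) := primesEquiv.symm ⟨q, hq⟩ with hvdef
      have hvq : (primesEquiv v : ℕ) = q := by rw [hvdef, Equiv.apply_symm_apply]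
      have hv : (p' : 𝓞 ℚ) ∉ v.asIdeal :=
        natCast_not_mem_asIdeal_of_primesEquiv_ne hp' (hvq ▸ hqp)
      have H := H4_cuspCoeff_eq_and_dvd_iff W f₀ hf₀ v
        (H3_map_localPolynomialAt_eq hCE W f₀ hf₀ p' ι ρg hρg hirr VQ eV heV he v hv)
      rwa [hvq] at H
  exact H5_isNewformOf_of_forall_prime_cuspCoeff_eq_of_dvd_iff W hf₀
    (fun q hq ↦ (key q hq).2) fun q hq ↦ (key q hq).1

/-- **G3.B3 (case `ℓ ∣ level`: NO Eichler–Shimura).**  If `ℓ` divides the level `N` of the descended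
newform then "off `N ℓ`" is "off `N`", so `E` itself is good off `N` and carries `a_p(f₀)` for
`p ∤ N`: `L_A` at `f₀` by G3.B1 with the curve `E`, then G3.B2. PROVED. -/
theorem isNewformOf_of_carayolEuler_of_dvd_level (hCE : Carayol1986_eulerFactor)
    (W : WeierstrassCurve ℚ) [W.IsElliptic] [NeZero (W.conductorNorm ℤ)] (ℓ : ℕ) [Fact ℓ.Prime]
    {N : ℕ} [NeZero N] (f₀ : CuspForm (Gamma0 N) 2) (hf₀ : IsNewform0 f₀)
    (hgood : ∀ v : HeightOneSpectrum (𝓞 ℚ), ¬ ((primesEquiv v : ℕ) ∣ N * ℓ) → W.HasGoodReductionAt v)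
    (hap : ∀ p : ℕ, p.Prime → ¬ p ∣ N * ℓ → cuspCoeff f₀ p = (W.LFunction p : ℂ))
    (hℓN : ℓ ∣ N) : IsNewformOf W f₀ := by
  have hℓ : ℓ.Prime := Fact.out
  have hiff : ∀ p : ℕ, p.Prime → p ∣ N * ℓ → p ∣ N := fun p hp h ↦
    (hp.dvd_mul.mp h).elim id fun h' ↦ by
      rw [(Nat.prime_dvd_prime_iff_eq hp hℓ).mp h']; exact hℓN
  have hgood' : ∀ v : HeightOneSpectrum (𝓞 ℚ), ¬ ((primesEquiv v : ℕ) ∣ N) →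
      W.HasGoodReductionAt v :=
    fun v hv ↦ hgood v fun h ↦ hv (hiff _ (primesEquiv v).2 h)
  have hap' : ∀ p : ℕ, p.Prime → ¬ p ∣ N → cuspCoeff f₀ p = (W.LFunction p : ℂ) :=
    fun p hp hpN ↦ hap p hp fun h ↦ hpN (hiff p hp h)
  exact isNewformOf_of_cofinalAt_of_carayolEuler hCE W f₀ hf₀ (T₀ := N * ℓ)
    (mul_ne_zero (NeZero.ne N) hℓ.ne_zero) hap (ratGaloisRepCofinalAt_of_curve W f₀ hf₀ hgood' hap')

/-- **G3.B4 (Brauer–Nesbitt transfer between two elliptic curves).**  If `W` is good off `M`,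
`a_p(E) = a_p(W)` for the primes `p ∤ M`, and `W` is good at `v`, then `E` is good at `v` with
`a_v(E) = a_v(W)`: at an auxiliary prime `p'` with `V_{p'}(W)` irreducible the frames of `V_{p'}(W)`,
`V_{p'}(E)` (`exists_framedGaloisRep_rationalTate`) agree off a finite set, so they are isomorphic
(`nonempty_equiv_of_hasFrobCharpolyAt_of_finite_of_isIrreducible`, Chebotarev + Brauer–Nesbitt, PROVED
in the tree); transport unramifiedness and the Frobenius polynomial at `v` (`isUnramifiedAt_of_equiv`,
`hasFrobCharpolyAt_of_equiv`), Néron–Ogg–Shafarevich for `E`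
(`hasGoodReductionAt_iff_forall_rationalGaloisRepTate_eq_one`, `neronOggShafarevich_holds`) and compare
`X`-coefficients.  No Faltings. PROVED. -/
theorem hasGoodReductionAt_and_lFunction_eq_of_ae_lFunction_eq
    (E W : WeierstrassCurve ℚ) [E.IsElliptic] [W.IsElliptic] {M : ℕ} (hM : M ≠ 0)
    (hWgood : ∀ v : HeightOneSpectrum (𝓞 ℚ), ¬ ((primesEquiv v : ℕ) ∣ M) → W.HasGoodReductionAt v)
    (hEW : ∀ p : ℕ, p.Prime → ¬ p ∣ M → E.LFunction p = W.LFunction p)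
    (v : HeightOneSpectrum (𝓞 ℚ)) (hv : W.HasGoodReductionAt v) :
    E.HasGoodReductionAt v ∧ E.LFunction (primesEquiv v : ℕ) = W.LFunction (primesEquiv v : ℕ) := by
  classical
  have hEpos : 0 < E.conductorNorm ℤ := E.conductorNorm_pos_holds
  have hq : (primesEquiv v : ℕ).Prime := (primesEquiv v).2
  -- an auxiliary prime `p' > M p_v N_E` with `V_{p'}(W)` irreducible
  obtain ⟨p', hp'F, hp'gt, hirrW⟩ :=
    W.exists_prime_gt_isIrreducible_rationalGaloisRepTate (M * ((primesEquiv v : ℕ) * E.conductorNorm ℤ))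
  haveI := hp'F
  have hp' : p'.Prime := hp'F.out
  have hB : M * ((primesEquiv v : ℕ) * E.conductorNorm ℤ) ≠ 0 :=
    mul_ne_zero hM (mul_ne_zero hq.ne_zero hEpos.ne')
  have hp'B : ¬ p' ∣ M * ((primesEquiv v : ℕ) * E.conductorNorm ℤ) := fun hd ↦ by
    have := Nat.le_of_dvd (Nat.pos_of_ne_zero hB) hd; omega
  have hp'E : ¬ p' ∣ E.conductorNorm ℤ := fun hd ↦
    hp'B (dvd_mul_of_dvd_right (dvd_mul_of_dvd_right hd _) _)
  have hvp' : (primesEquiv v : ℕ) ≠ p' := fun h ↦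
    hp'B (dvd_mul_of_dvd_right (dvd_mul_of_dvd_left (by rw [h]) _) _)
  have hp'v : (p' : 𝓞 ℚ) ∉ v.asIdeal := natCast_not_mem_asIdeal_of_primesEquiv_ne hp' hvp'
  -- frames of `V_{p'}(W)` and `V_{p'}(E)`
  obtain ⟨VW, eW, heW, hVW⟩ := exists_framedGaloisRep_rationalTate W p'
  obtain ⟨VE, eE, heE, hVE⟩ := exists_framedGaloisRep_rationalTate E p'
  have hirrVW : FramedRep.IsIrreducible VW :=
    (Representation.isIrreducible_iff_of_equivariant (FramedRep.toRepresentation VW)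
      (W.rationalGaloisRepTate p') (MonoidHom.id _) Function.surjective_id eW
      (fun g x ↦ by rw [MonoidHom.id_apply]; exact heW g x)).mpr hirrW
  have hirrVW' : VW.toGaloisRep.IsIrreducible :=
    (FramedRep.isIrreducible_toContinuousRep_iff VW).mpr hirrVW
  -- the finite exceptional set `{w : p_w ∣ M N_E p'}`
  have hT : M * (E.conductorNorm ℤ * p') ≠ 0 := mul_ne_zero hM (mul_ne_zero hEpos.ne' hp'.ne_zero)
  set S : Set (HeightOneSpectrum (𝓞 ℚ)) :=
    {w | ((primesEquiv w : Nat.Primes) : ℕ) ∣ M * (E.conductorNorm ℤ * p')} with hSdef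
  have hS : S.Finite := by
    have hfin : {n : ℕ | n ∣ M * (E.conductorNorm ℤ * p')}.Finite :=
      (M * (E.conductorNorm ℤ * p')).divisors.finite_toSet.subset
        fun n hn ↦ Nat.mem_divisors.mpr ⟨hn, hT⟩
    exact (hfin.preimage (f := fun w : HeightOneSpectrum (𝓞 ℚ) ↦ ((primesEquiv w : Nat.Primes) : ℕ))
      fun _ _ _ _ h ↦ primesEquiv.injective (Subtype.ext h)).subset fun w hw ↦ hw
  -- agreement of the two frames off `S`
  have hST : ∀ w ∉ S, VW.IsUnramifiedAt w ∧ VE.IsUnramifiedAt w ∧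
      ∃ P : Polynomial ℚ_[p'], VW.HasFrobCharpolyAt w P ∧ VE.HasFrobCharpolyAt w P := by
    intro w hw
    have hqw : (primesEquiv w : ℕ).Prime := (primesEquiv w).2
    have hwT : ¬ (primesEquiv w : ℕ) ∣ M * (E.conductorNorm ℤ * p') := hw
    have hwM : ¬ (primesEquiv w : ℕ) ∣ M := fun h ↦ hwT (dvd_mul_of_dvd_left h _)
    have hwE : ¬ (primesEquiv w : ℕ) ∣ E.conductorNorm ℤ := fun h ↦
      hwT (dvd_mul_of_dvd_right (dvd_mul_of_dvd_left h _) _)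
    have hwp : (primesEquiv w : ℕ) ≠ p' := fun h ↦
      hwT (dvd_mul_of_dvd_right (dvd_mul_of_dvd_right (by rw [h]) _) _)
    have hp'w : (p' : 𝓞 ℚ) ∉ w.asIdeal := natCast_not_mem_asIdeal_of_primesEquiv_ne hp' hwp
    have hgoodW : W.HasGoodReductionAt w := hWgood w hwM
    have hgoodE : E.HasGoodReductionAt w := by
      by_contra hbad
      exact hwE ((E.dvd_conductorNorm_iff w).mpr hbad)
    obtain ⟨hurW, hchW⟩ := hVW w hp'w hgoodW
    obtain ⟨hurE, hchE⟩ := hVE w hp'w hgoodE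
    refine ⟨hurW, hurE, _, hchW, ?_⟩
    rw [← hEW _ hqw hwM]
    exact hchE
  obtain ⟨e⟩ := FramedGaloisRep.nonempty_equiv_of_hasFrobCharpolyAt_of_finite_of_isIrreducible
    hS VW VE hirrVW' hST
  -- transport `W`'s local data at `v` to the frame of `V_{p'}(E)`
  obtain ⟨hurWv, hchWv⟩ := hVW v hp'v hv
  have hurEv : VE.IsUnramifiedAt v := FramedGaloisRep.isUnramifiedAt_of_equiv e hurWv
  have hchEv := FramedGaloisRep.hasFrobCharpolyAt_of_equiv e hchWv
  -- `E` is good at `v` (Néron–Ogg–Shafarevich for `V_{p'}(E)`)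
  have hgoodEv : E.HasGoodReductionAt v := by
    refine (E.hasGoodReductionAt_iff_forall_rationalGaloisRepTate_eq_one p'
      E.neronOggShafarevich_holds hp'v).mpr ?_
    intro 𝔓 h𝔓 τ hτ
    have h1 : VE τ = 1 := hurEv 𝔓 h𝔓 τ hτ
    refine LinearMap.ext fun y ↦ ?_
    obtain ⟨x, rfl⟩ := eE.surjective y
    rw [← heE τ x, FramedRep.toRepresentation_apply_apply, h1]
    simp
  -- `E`'s own Frobenius polynomial at `v`; compare `X`-coefficients
  obtain ⟨-, hchEv'⟩ := hVE v hp'v hgoodEv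
  obtain ⟨𝔓, h𝔓⟩ := primesAbove_nonempty v
  obtain ⟨σ, hσ⟩ := exists_isArithFrobAt_of_mem_primesAbove_holds (v := v) h𝔓
  have hPQ := (hchEv 𝔓 h𝔓 σ hσ).symm.trans (hchEv' 𝔓 h𝔓 σ hσ)
  have hc := congrArg (fun P : Polynomial ℚ_[p'] ↦ P.coeff 1) hPQ
  simp only [coeff_one_X_sq_sub_C_mul_X_add_C', neg_inj] at hc
  refine ⟨hgoodEv, ?_⟩
  exact_mod_cast hc.symm

/-- **G3.B5 (case `ℓ ∤ level`, `E` good at `ℓ`: the child is consumed at ONE coefficient, `a_ℓ`).**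
`E` is good off `N`; `a_p(f₀) = a_p(E)` for `p ∤ N`, `p ≠ ℓ` by descent, and at `p = ℓ` because the
child gives `a_ℓ(f₀) = a_ℓ(E_f)` and the transfer G3.B4 (`E_f` vs `E`, equal `a_p` off `N ℓ`) gives
`a_ℓ(E_f) = a_ℓ(E)`; then G3.B1 with the curve `E` and G3.B2.  (The case `ℓ ∣ N` is G3.B3.) PROVED. -/
theorem isNewformOf_of_congruenceRelation_of_carayolEuler_of_hasGoodReductionAt
    (hCR : EichlerShimuraCongruenceRelation) (hCE : Carayol1986_eulerFactor)
    (W : WeierstrassCurve ℚ) [W.IsElliptic] [NeZero (W.conductorNorm ℤ)] (ℓ : ℕ) [Fact ℓ.Prime]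
    {N : ℕ} [NeZero N] (f₀ : CuspForm (Gamma0 N) 2) (hf₀ : IsNewform0 f₀)
    (hrat : ∀ n : ℕ, ∃ z : ℤ, cuspCoeff f₀ n = z)
    (hgood : ∀ v : HeightOneSpectrum (𝓞 ℚ), ¬ ((primesEquiv v : ℕ) ∣ N * ℓ) → W.HasGoodReductionAt v)
    (hap : ∀ p : ℕ, p.Prime → ¬ p ∣ N * ℓ → cuspCoeff f₀ p = (W.LFunction p : ℂ))
    (hℓ : W.HasGoodReductionAt (primesEquiv.symm ⟨ℓ, Fact.out⟩ : HeightOneSpectrum (𝓞 ℚ))) :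
    IsNewformOf W f₀ := by
  classical
  have hℓp : ℓ.Prime := Fact.out
  by_cases hℓN : ℓ ∣ N
  · exact isNewformOf_of_carayolEuler_of_dvd_level hCE W ℓ f₀ hf₀ hgood hap hℓN
  have hvℓ : (primesEquiv (primesEquiv.symm ⟨ℓ, hℓp⟩ : HeightOneSpectrum (𝓞 ℚ)) : ℕ) = ℓ := by
    rw [Equiv.apply_symm_apply]
  -- `E` is good off `N`
  have hgoodN : ∀ v : HeightOneSpectrum (𝓞 ℚ), ¬ ((primesEquiv v : ℕ) ∣ N) →
      W.HasGoodReductionAt v := by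
    intro v hv
    by_cases hvl : (primesEquiv v : ℕ) = ℓ
    · have : v = (primesEquiv.symm ⟨ℓ, hℓp⟩ : HeightOneSpectrum (𝓞 ℚ)) := by
        apply primesEquiv.injective
        rw [Equiv.apply_symm_apply]
        exact Subtype.ext hvl
      rw [this]; exact hℓ
    · exact hgood v fun h ↦ ((primesEquiv v).2.dvd_mul.mp h).elim hv
        fun h' ↦ hvl ((Nat.prime_dvd_prime_iff_eq (primesEquiv v).2 hℓp).mp h')
  -- the curve `E_f` of the child: `a_p(E_f) = a_p(f₀)` for `p ∤ N`
  have hQ : coeffField f₀ = ⊥ := coeffField_eq_bot_of_forall_exists_intCast hrat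
  obtain ⟨E, hE, hapE⟩ :=
    exists_weierstrassCurve_of_rational_isNewform0_of_congruenceRelation (hCR N) f₀ hf₀ hQ
  haveI := hE
  have hEW : ∀ p : ℕ, p.Prime → ¬ p ∣ N * ℓ → E.LFunction p = W.LFunction p := by
    intro p hp hpNℓ
    have hpN : ¬ p ∣ N := fun h ↦ hpNℓ (dvd_mul_of_dvd_left h _)
    have h1 := hapE p hp hpN
    have h2 := hap p hp hpNℓ
    rw [cuspCoeff, h1] at h2
    exact_mod_cast h2
  -- at `ℓ`: `a_ℓ(E_f) = a_ℓ(E)` by the Brauer–Nesbitt transfer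
  obtain ⟨-, haℓ⟩ := hasGoodReductionAt_and_lFunction_eq_of_ae_lFunction_eq E W
    (mul_ne_zero (NeZero.ne N) hℓp.ne_zero) hgood hEW _ hℓ
  rw [hvℓ] at haℓ
  -- hence `a_p(f₀) = a_p(E)` for every `p ∤ N`
  have hapN : ∀ p : ℕ, p.Prime → ¬ p ∣ N → cuspCoeff f₀ p = (W.LFunction p : ℂ) := by
    intro p hp hpN
    by_cases hpℓ : p = ℓ
    · rw [hpℓ, cuspCoeff, hapE ℓ hℓp hℓN, haℓ]
    · exact hap p hp fun h ↦ (hp.dvd_mul.mp h).elim hpN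
        fun h' ↦ hpℓ ((Nat.prime_dvd_prime_iff_eq hp hℓp).mp h')
  exact isNewformOf_of_cofinalAt_of_carayolEuler hCE W f₀ hf₀ (T₀ := N * ℓ)
    (mul_ne_zero (NeZero.ne N) hℓp.ne_zero) hap (ratGaloisRepCofinalAt_of_curve W f₀ hf₀ hgoodN hapN)

/-- **G3.B6 — THE `ℓ`-HOLE THEOREM (per curve, from the two CATALOGUED facts + Carayol-level).**
`ρ_{E,ℓ}` modular and `ℓ ∤ N_E` ⇒ `E` modular.  PROVED, 0 sorries. -/
theorem isModular_of_isModularGaloisRepTate_of_congruenceRelation_of_carayolEuler_of_not_dvd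
    (hCR : EichlerShimuraCongruenceRelation) (hCE : Carayol1986_eulerFactor)
    (hC : ∀ (N : ℕ) [NeZero N], IsNewformOf.level_eq_conductorNorm (N := N))
    (W : WeierstrassCurve ℚ) [W.IsElliptic] [NeZero (W.conductorNorm ℤ)] (ℓ : ℕ) [Fact ℓ.Prime]
    (h : W.IsModularGaloisRepTate ℓ) (hℓ : ¬ ℓ ∣ W.conductorNorm ℤ) : BCDT.IsModular W := by
  have hℓp : ℓ.Prime := Fact.out
  obtain ⟨N, hN, f₀, hf₀, hrat, hgood, hap⟩ :=
    H1r_exists_rational_isNewform0_hasGoodReductionAt_cuspCoeff_eq W ℓ h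
  have hv : W.HasGoodReductionAt (primesEquiv.symm ⟨ℓ, Fact.out⟩ : HeightOneSpectrum (𝓞 ℚ)) := by
    by_contra hbad
    have hd := (W.dvd_conductorNorm_iff (primesEquiv.symm ⟨ℓ, hℓp⟩ : HeightOneSpectrum (𝓞 ℚ))).mpr hbad
    rw [Equiv.apply_symm_apply] at hd
    exact hℓ hd
  have hWf := isNewformOf_of_congruenceRelation_of_carayolEuler_of_hasGoodReductionAt hCR hCE W ℓ f₀
    hf₀ hrat hgood hap hv
  have hNW : N = W.conductorNorm ℤ := hC N hWf
  subst hNW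
  exact ⟨f₀, hWf⟩

/-- **G3.B6′ (semistable: Carayol-level not needed).** PROVED. -/
theorem isModular_of_isModularGaloisRepTate_of_congruenceRelation_of_carayolEuler_of_squarefree
    (hCR : EichlerShimuraCongruenceRelation) (hCE : Carayol1986_eulerFactor)
    (W : WeierstrassCurve ℚ) [W.IsElliptic] [NeZero (W.conductorNorm ℤ)]
    (hsq : Squarefree (W.conductorNorm ℤ)) (ℓ : ℕ) [Fact ℓ.Prime]
    (h : W.IsModularGaloisRepTate ℓ) (hℓ : ¬ ℓ ∣ W.conductorNorm ℤ) : BCDT.IsModular W := by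
  have hℓp : ℓ.Prime := Fact.out
  obtain ⟨N, hN, f₀, hf₀, hrat, hgood, hap⟩ :=
    H1r_exists_rational_isNewform0_hasGoodReductionAt_cuspCoeff_eq W ℓ h
  have hv : W.HasGoodReductionAt (primesEquiv.symm ⟨ℓ, Fact.out⟩ : HeightOneSpectrum (𝓞 ℚ)) := by
    by_contra hbad
    have hd := (W.dvd_conductorNorm_iff (primesEquiv.symm ⟨ℓ, hℓp⟩ : HeightOneSpectrum (𝓞 ℚ))).mpr hbad
    rw [Equiv.apply_symm_apply] at hd
    exact hℓ hd
  have hWf := isNewformOf_of_congruenceRelation_of_carayolEuler_of_hasGoodReductionAt hCR hCE W ℓ f₀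
    hf₀ hrat hgood hap hv
  have hNW : N = W.conductorNorm ℤ := hWf.level_eq_conductorNorm_of_squarefree hsq
  subst hNW
  exact ⟨f₀, hWf⟩

/-- **The residual input, minimal form (`HoleFiller`).**  For descended data
(`f₀` rational newform of level `N`, `E` good off `N ℓ`, `a_p(f₀) = a_p(E)` off `N ℓ`):
`ℓ ∤ N ⇒ ℓ ∤ N_E`.  True (level = conductor, Carayol), but the point is that THIS is all an
Eichler–Shimura-type existence theorem is used for beyond the catalogued child; it follows from
`IgusaGoodReduction` (G3.B7), from Carayol (A) granted Deligne's `ρ_{f₀,p'}`, or from `p`-adic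
local–global compatibility at `p = ℓ` (Saito 1997). -/
def HoleFiller : Prop :=
  ∀ (W : WeierstrassCurve ℚ) [W.IsElliptic] (ℓ : ℕ) [Fact ℓ.Prime] {N : ℕ} [NeZero N]
    (f₀ : CuspForm (Gamma0 N) 2), IsNewform0 f₀ → (∀ n : ℕ, ∃ z : ℤ, cuspCoeff f₀ n = z) →
    (∀ v : HeightOneSpectrum (𝓞 ℚ), ¬ ((primesEquiv v : ℕ) ∣ N * ℓ) → W.HasGoodReductionAt v) →
    (∀ p : ℕ, p.Prime → ¬ p ∣ N * ℓ → cuspCoeff f₀ p = (W.LFunction p : ℂ)) →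
    ¬ ℓ ∣ N → ¬ ℓ ∣ W.conductorNorm ℤ

/-- **G3.B7 child + Igusa ⇒ `HoleFiller`** (transfer G3.B4 with the roles swapped: `E_f` is good off
`N`, in particular at `ℓ ∤ N`, and carries `a_p(E)` off `N ℓ`). PROVED. -/
theorem holeFiller_of_congruenceRelation_of_igusa (hCR : EichlerShimuraCongruenceRelation)
    (hIg : IgusaGoodReduction) : HoleFiller := by
  intro W _ ℓ _ N _ f₀ hf₀ hrat hgood hap hℓN
  classical
  have hℓp : ℓ.Prime := Fact.out
  have hQ : coeffField f₀ = ⊥ := coeffField_eq_bot_of_forall_exists_intCast hrat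
  obtain ⟨Lf, hLf⟩ := hf₀.exists_periodPair_of_coeffField_eq_bot hQ
  obtain ⟨a₄, a₆, h₂, h₃⟩ := hf₀.exists_rat_g₂_g₃_of_lattice_eq_periodLattice hQ Lf hLf
  haveI := isElliptic_shortModel h₂ h₃
  have hEgood : ∀ v : HeightOneSpectrum (𝓞 ℚ), ¬ ((primesEquiv v : ℕ) ∣ N * ℓ) →
      ({ a₁ := 0, a₂ := 0, a₃ := 0, a₄ := a₄, a₆ := a₆ } : WeierstrassCurve ℚ).HasGoodReductionAt v :=
    fun v hv ↦ hIg N f₀ hf₀ hQ Lf hLf a₄ a₆ h₂ h₃ v fun h ↦ hv (dvd_mul_of_dvd_left h _)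
  have hWE : ∀ p : ℕ, p.Prime → ¬ p ∣ N * ℓ →
      W.LFunction p =
        ({ a₁ := 0, a₂ := 0, a₃ := 0, a₄ := a₄, a₆ := a₆ } : WeierstrassCurve ℚ).LFunction p := by
    intro p hp hpNℓ
    have hpN : ¬ p ∣ N := fun h ↦ hpNℓ (dvd_mul_of_dvd_left h _)
    have h1 := hCR N f₀ hf₀ hQ Lf hLf a₄ a₆ h₂ h₃ p hp hpN
    have h2 := hap p hp hpNℓ
    rw [cuspCoeff, h1] at h2
    exact_mod_cast h2.symm
  set v : HeightOneSpectrum (𝓞 ℚ) := primesEquiv.symm ⟨ℓ, hℓp⟩ with hvdef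
  have hvℓ : (primesEquiv v : ℕ) = ℓ := by rw [hvdef, Equiv.apply_symm_apply]
  have hℓN' : ¬ ((primesEquiv v : ℕ) ∣ N) := by rw [hvℓ]; exact hℓN
  have hEv := hIg N f₀ hf₀ hQ Lf hLf a₄ a₆ h₂ h₃ v hℓN'
  obtain ⟨hWv, -⟩ := hasGoodReductionAt_and_lFunction_eq_of_ae_lFunction_eq W _
    (mul_ne_zero (NeZero.ne N) hℓp.ne_zero) hEgood hWE v hEv
  intro hdvd
  have hd : (primesEquiv v : ℕ) ∣ W.conductorNorm ℤ := by rw [hvℓ]; exact hdvd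
  exact ((W.dvd_conductorNorm_iff v).mp hd) hWv

/-- **G3.B8 (closer from child + Carayol-Euler + Carayol-level + `HoleFiller`).**  By cases on
`ℓ ∣ N` (G3.B3) / `ℓ ∤ N` (HoleFiller ⇒ `E` good at `ℓ`, G3.B5). PROVED. -/
theorem threeImpTwo_of_congruenceRelation_of_carayolEuler_of_holeFiller
    (hCR : EichlerShimuraCongruenceRelation) (hCE : Carayol1986_eulerFactor)
    (hC : ∀ (N : ℕ) [NeZero N], IsNewformOf.level_eq_conductorNorm (N := N))
    (hHF : HoleFiller) : SigStubThreeImpTwo := by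
  intro W _ _ ℓ _ h
  have hℓp : ℓ.Prime := Fact.out
  obtain ⟨N, hN, f₀, hf₀, hrat, hgood, hap⟩ :=
    H1r_exists_rational_isNewform0_hasGoodReductionAt_cuspCoeff_eq W ℓ h
  have hWf : IsNewformOf W f₀ := by
    by_cases hℓN : ℓ ∣ N
    · exact isNewformOf_of_carayolEuler_of_dvd_level hCE W ℓ f₀ hf₀ hgood hap hℓN
    · have hℓW := hHF W ℓ f₀ hf₀ hrat hgood hap hℓN
      have hv : W.HasGoodReductionAt (primesEquiv.symm ⟨ℓ, Fact.out⟩ : HeightOneSpectrum (𝓞 ℚ)) := by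
        by_contra hbad
        have hd := (W.dvd_conductorNorm_iff (primesEquiv.symm ⟨ℓ, hℓp⟩ : HeightOneSpectrum (𝓞 ℚ))).mpr hbad
        rw [Equiv.apply_symm_apply] at hd
        exact hℓW hd
      exact isNewformOf_of_congruenceRelation_of_carayolEuler_of_hasGoodReductionAt hCR hCE W ℓ f₀
        hf₀ hrat hgood hap hv
  have hNW : N = W.conductorNorm ℤ := hC N hWf
  subst hNW
  exact ⟨f₀, hWf⟩

/-- Sanity (gen 3): the verbatim stub from child + Igusa + Carayol-Euler + Carayol-level, by the
`ℓ`-hole road (agrees with G3.A3). -/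
example (hCR : EichlerShimuraCongruenceRelation) (hIg : IgusaGoodReduction)
    (hCE : Carayol1986_eulerFactor)
    (hC : ∀ (N : ℕ) [NeZero N], IsNewformOf.level_eq_conductorNorm (N := N)) :
    ∀ (W : WeierstrassCurve ℚ) [W.IsElliptic] [NeZero (W.conductorNorm ℤ)] (ℓ : ℕ) [Fact ℓ.Prime],
      W.IsModularGaloisRepTate ℓ → BCDT.IsModular W :=
  threeImpTwo_of_congruenceRelation_of_carayolEuler_of_holeFiller hCR hCE hC
    (holeFiller_of_congruenceRelation_of_igusa hCR hIg)

end Summit.ABC.ABC.Cruxes.FreyModularity.Sketch.StubIdeasThreeImpTwo1
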